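import Summits.PneNP.PneNP.Theses.OneSlice
import Literature.Computability.Complexity.CircuitRestriction
import Literature.Computability.Complexity.Rossman2008CliqueProofs
import Literature.Computability.Complexity.RossmanMonotoneCliqueProofs
import Literature.Computability.Complexity.ACRealizeConnectives
import Literature.Computability.Complexity.CircuitInputMap
import Literature.Computability.Complexity.FourierTails
import Literature.Computability.Complexity.ACFourierTails
import Mathlib.Algebra.Order.Field.GeomSum
import Mathlib.RingTheory.Polynomial.Bernstein
import Mathlib.Analysis.SpecialFunctions.Pow.Real

/-!
# drefute gen-3 (refuter-drefute-stmt-PneNP-2835-g3-0): the skeleton line `russo-window-ladder` COMPLETED — all five stubs proved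

This is `Lines/russo-window-ladder.lean` (sha d000db28, the lead's L1 reshape) VERBATIM, in the namespace
`…Cruxes.SliceACZero.DrefuteG3Complete` (renamed to avoid clashing with the skeleton's FQNs), with the refuter's kernel-checked
proofs of the five stubs inserted as sub-namespaces `S1 … S4b` and the five `by sorry` replaced by them; `sliceACZero_proved :
Summit.PneNP.PneNP.Theses.OneSlice.SliceACZero` at the end is sorry-free with axioms [propext, Classical.choice, Quot.sound]
(`lean check --no-snap --axioms`). CANDIDATE PROOF EVIDENCE ONLY — a refuter does not land positive statements; the lead /
a prover splits this into `Theorems/` files and proposes. Report: `Cruxes/SliceACZero/DREFUTE-g3-russo-window-ladder.md`.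

## Original skeleton docblock

Route `PneNP/OneSlice`; crux decl `Summit.PneNP.PneNP.Theses.OneSlice.SliceACZero` = `Hyp → Conc`
(`Hyp`: fixed-δ, window-uniform single-threshold average-case AC⁰ lower bound for k-CLIQUE on `G(n,q)`;
`Conc`: the same on every central Hamming slice `G(n,j)`; read back here DEFINITIONALLY as
`CruxHyp → CruxConc`, `sliceACZero_iff : SliceACZero ↔ (CruxHyp → CruxConc) := Iff.rfl`, in the vocabulary
`mk`/`sliceErr`/`sliceCard`/`gnpDisagreeProb`/`cliqueFn` of `Cruxes/SliceACZero/Disproof.lean`); idea card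
`Cruxes/SliceACZero/Ideas/russo-window-ladder.md` (ideator 2; triage r1: pass ×3 — the sharpenings "single density
with hybrid weights instead of the dyadic ladder" and "AND-coin instead of the comparator blow-up" are adopted).

THE LINE (Russo–Margulis read slice by slice). For a Boolean `f` on a finite cube `{0,1}^ι`, `N = |ι|`:
`a_ℓ(f)` = fraction of slice `ℓ` where `f = 1` (`sliceAvg`, count/count), `E_q f` = `μ_q`-mass of `{f = 1}`
(`prodAvg`), `upPivotal f` = the bichromatic UP-edges `(x,i)` (`x_i = 0`, `f x ≠ f (x + e_i)`),
`I_q(f) = Σ_{(x,i) ∈ upPivotal f} q^{|x|}(1-q)^{N-1-|x|}` = the UNSIGNED `μ_q`-total influence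
(`biasedInfluence`; at `q = 1/2` it is the ordinary total influence `#upPivotal · 2^{1-N}`). FOUR STUBS:
* S1 `stub_sliceCoupling` (the lever; exact combinatorics, every `f`, every `q ∈ [0,1]`, `j ≤ N`; M): walking the
  uniform increasing path, `|a_{ℓ+1} − a_ℓ| ≤ β_ℓ/((N−ℓ)C(N,ℓ))` (`β_ℓ` = # up-pivotal edges at level `ℓ`),
  `E_q f = Σ_ℓ B_{N,q}(ℓ) a_ℓ`, telescoping from `j`: `|E_q f − a_j f| ≤ Σ_{(x,i) ∈ upPivotal f}
  w_{q,j}(|x|)/((N−|x|)C(N,|x|))` with the HYBRID WEIGHT `w_{q,j}(i) = P[Bin(N,q) ≥ i+1]` (`i ≥ j`),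
  `= P[Bin(N,q) ≤ i]` (`i < j`) (`hybridWeight`). This is the card's `RussoSliceIdentity`/`LadderIneq` with every
  level charged its own binomial weight at ONE density (Filmus–Mossel Lemma 8.2–8.3 form, triage r1-1/2/3).
* S2 `stub_binomialHazard` (binomial analysis; M): at `q = j/N`, `0 < j < N`: `w_{q,j}(i)/((N−i)C(N,i)) ≤
  K₀/√j · q^{i+1}(1−q)^{N−1−i}` (log-concavity ⇒ monotone hazard ratios; modal mass `≥ 3/(20√j)` by Chebyshev +
  unimodality; `(i+1)C(N,i+1) = (N−i)C(N,i)`; `K₀ = 40/3` works, brute force needs `1.06` for `N ≤ 60`).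
  S1+S2 ⇒ `|E_{j/N} f − a_j f| ≤ K₀ · (q·I_q f)/√j` (PROVED here: `hybrid_le`).
* S3 `stub_andCoin` (exact identity, every `f`, `0 ≤ q ≤ 1/2`; S/M): `2q·I_q(f) = Σ_y μ_{2q}(y)·I_{1/2}(f_y)`,
  `f_y(z) = f(y ∧ z)` — biased influence is an average of UNBIASED influences of random 0-restrictions (the card's
  blow-up identity with the gadget `∧`; triage r1-1 sharpening; brute force exact).
* S4 `stub_boppana` (the analytic heart, HARDEST; M/L): an `acBasis` circuit of `acDepth ≤ d` has
  `I_{1/2} ≤ K_d (log(size+2))^{B_d}`, uniformly in the number of inputs (Boppana 1997 / LMN, from the in-tree Tal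
  theorem `ACForm.tailWeight_le_tailBound` + `Circuit.exists_acForm` via `I = Σ_k W^{≥k}`).
  S3+S4+`Circuit.exists_restrict` ⇒ `q·I_q(C) ≤ K_{d+1} (log(size+3))^{B}/2` (PROVED here: `biased_le`).
PROVED GLUE: S1–S4 ⇒ `SliceIndist` (`sliceIndist_of`; rate `polylog(j)/√j → 0`, `rate_eventually`): for
`j ≥ j₀(d,c,ε)` and `2j ≤ N`, no `acBasis` circuit of `acDepth ≤ d` and `≤ j^c` gates distinguishes slice `j` from
`μ_{j/N}` with advantage `> ε`, on ANY finite cube — the card's `Transfer` C⁺ (CLIQUE, `k`, `δ`, `Hyp` deleted);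
and the REDUCTION `transfer : SliceIndist → CruxHyp → CruxConc` (the card's `Reduction`, formerly a fifth stub, now
kernel-checked): given `Hyp` and `(d,c)` take `(k, δ_H)` from `Hyp d c`, answer with the same `k` and `δ := δ_H/2`;
`window_eventually` (central `j` ⇒ `j ≥ j₀`, `n ≤ 5j`, `2j ≤ C(n,2)`, eventually in `n`, uniformly in `j`; uses
`3 ≤ k`), `exists_xorClique_circuit` (`G = [C ≠ CLIQUE_k]` over `acBasis`, `acDepth ≤ d+4`, `≤ 2(|C|+C(n,k)+1)+5
≤ j^{2(c+k)+8}` gates — `exists_cliqueDNF_monotoneAC` + `acReal_and/or/neg`, `size_bound`), `sliceAvg_edge_eq` /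
`prodAvg_edge_eq` (`a_j(G) = sliceErr/sliceCard`, `E_{j/C(n,2)} G = gnpDisagreeProb`; `wt = edgeCount` rfl,
`card_edgeSet_top_fin`), then `Hyp` at `q = j/C(n,2) ∈ [0,1]` (window clause `|q·C(n,2) − m_k| = |j − m_k|`
verbatim). `SliceACZero_of` composes (conclusion = the route decl BY NAME; hypotheses = the `Registered.stub_*`
aliases); the closing `example : SliceACZero` feeds it the four registered stubs.

DISPROOF USED (`Cruxes/SliceACZero/Disproof.lean`, cdisprove v3, read in full): `not_innerConcNoWindow` /
`not_innerConcWindowAbove` — the centrality clause is consumed in `window_eventually` (to get `j → ∞`, which drives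
the rate, and `2j ≤ C(n,2)`, i.e. `q ≤ 1/2 ≤ 1`) and passed verbatim to `Hyp`'s window clause in `transfer`;
`not_innerConcNoBasis` — `acBasis` enters through S4 (an arbitrary gate has no influence bound) and through `Hyp`
applied to `C` itself; `not_innerConcNoError` — the error hypothesis is the input `a_j(G) ≤ δ`; Part II
(`lt_of_innerHyp`: `c < k`) and Part IV (`δ < 1/k!`) are inherited from `Hyp`'s witness (`k`, `δ_H/2`); Part III
`sliceTarget_of_concNoDepth` is respected: S4's `B_d` grows with `d`, the lever dies at unbounded depth. No Negative
lemma has landed under `Theorems/SliceACZero/Negative/` (nothing to import); no stub mentions CLIQUE, the window,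
the route decl or a refuted statement (`ledger negatives --problem PneNP`: 5 entries, none on slices / AC⁰
influence). Brute-force checks of S1 (exact, 360 random cases `N ≤ 6`), S2 (constant `≤ 1.06`, `N ≤ 60`), S3 (exact,
150 cases) in `checks_stubs.py` (evidence on the item).

Conventions (as in `Cruxes/CliqueExtLowerBound/Lines/event-sandwich-interpolation.lean`): `sorry` appears ONLY
inside the four `stub_*` theorems; the statements are the named `Prop`s `…Stmt`, restated verbatim by the stubs;
`Registered.stub_*` are their name-keyed aliases used as the hypotheses of `SliceACZero_of`.
-/

set_option linter.unusedVariables false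
set_option linter.dupNamespace false
set_option linter.unusedSimpArgs false

noncomputable section

namespace Summit.PneNP.PneNP.Cruxes.SliceACZero.DrefuteG3Complete

open scoped BigOperators
open Finset Filter Literature.Computability.Complexity
open Literature.Computability.Complexity.LowDegree (tailWeight)
open Literature.Probability.RandomGraphs.LowDegree (sgn)
open Summit.PneNP.PneNP.Theses.OneSlice (SliceACZero)

/-! ### Vocabulary on a finite cube `{0,1}^ι` -/

section Vocabulary

variable {ι : Type} [Fintype ι] [DecidableEq ι]

/-- `|x|`: the number of ones of `x` (on edge vectors this is `edgeCount`, definitionally). [folklore] -/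
def wt (x : ι → Bool) : ℕ := #(univ.filter fun i => x i = true)

/-- The `μ_q` (product, `q`-biased) weight of a point: `q^{|x|}(1−q)^{N−|x|}` (on edge vectors: `gnpWeight`,
up to `Fintype.card = C(n,2)`). [folklore] -/
def prodWeight (q : ℝ) (x : ι → Bool) : ℝ := q ^ wt x * (1 - q) ^ (Fintype.card ι - wt x)

/-- `E_{μ_q}[f] = Pr_{μ_q}[f = 1]` as a finite sum (on edge vectors with `f = [C ≠ CLIQUE_k]`:
`gnpDisagreeProb`). [folklore] -/
def prodAvg (q : ℝ) (f : (ι → Bool) → Bool) : ℝ :=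
  ∑ x ∈ univ.filter (fun x : ι → Bool => f x = true), prodWeight q x

/-- `a_ℓ(f)`: the fraction of the Hamming slice `{|x| = ℓ}` (of size `C(N,ℓ)`; written as a count so that on edge
vectors the denominator is literally the Disproof's `sliceCard`) on which `f = 1`. [folklore] -/
def sliceAvg (f : (ι → Bool) → Bool) (ℓ : ℕ) : ℝ :=
  (#(univ.filter fun x : ι → Bool => wt x = ℓ ∧ f x = true) : ℝ) / (#(univ.filter fun x : ι → Bool => wt x = ℓ) : ℝ)

/-- The bichromatic UP-edges of `f`: pairs `(x, i)` with `x_i = 0` and `f x ≠ f (x with x_i := 1)`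
(each pivotal hypercube edge counted once, from its lower endpoint). [folklore] -/
def upPivotal (f : (ι → Bool) → Bool) : Finset ((ι → Bool) × ι) :=
  univ.filter fun p => p.1 p.2 = false ∧ f p.1 ≠ f (Function.update p.1 p.2 true)

/-- The UNSIGNED `μ_q`-total influence `I_q(f) = Σ_i Pr_{x ∼ μ_q}[i pivotal for f at x]`, written as the sum over
up-pivotal edges `(x,i)` of the `μ_q`-weight of `x` off coordinate `i`, `q^{|x|}(1−q)^{N−1−|x|}`; at `q = 1/2`
this is the ordinary total influence `I[f] = #upPivotal(f) · 2^{1−N}` (O'Donnell 2014 §2.2, §8.4). [folklore] -/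
def biasedInfluence (q : ℝ) (f : (ι → Bool) → Bool) : ℝ :=
  ∑ p ∈ upPivotal f, q ^ wt p.1 * (1 - q) ^ (Fintype.card ι - 1 - wt p.1)

end Vocabulary

/-- The binomial point mass `P[Bin(N,q) = ℓ] = C(N,ℓ) q^ℓ (1−q)^{N−ℓ}`. [folklore] -/
def binomPMF (N : ℕ) (q : ℝ) (ℓ : ℕ) : ℝ := (N.choose ℓ : ℝ) * q ^ ℓ * (1 - q) ^ (N - ℓ)

/-- The HYBRID WEIGHT of level `i` seen from slice `j`: the `Bin(N,q)`-mass strictly above `i` if `j ≤ i`, the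
mass at or below `i` if `i < j` (the mass of the levels `ℓ` whose monotone path from `j` to `ℓ` crosses the
edge layer `i → i+1`; Filmus–Mossel hybrid argument). [folklore] -/
def hybridWeight (N : ℕ) (q : ℝ) (j i : ℕ) : ℝ :=
  if j ≤ i then ∑ ℓ ∈ Finset.Ioc i N, binomPMF N q ℓ else ∑ ℓ ∈ Finset.range (i + 1), binomPMF N q ℓ

/-! ### The four stub STATEMENTS (named `Prop`s) and the line's C⁺ -/

/-- Statement of STUB 1 (slice coupling / Russo–Margulis read slice by slice). [folklore] -/
def SliceCouplingStmt : Prop :=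
  ∀ (ι : Type) [Fintype ι] [DecidableEq ι] (f : (ι → Bool) → Bool) (q : ℝ), 0 ≤ q → q ≤ 1 →
    ∀ j : ℕ, j ≤ Fintype.card ι →
      |prodAvg q f - sliceAvg f j| ≤
        ∑ p ∈ upPivotal f, hybridWeight (Fintype.card ι) q j (wt p.1) /
          (((Fintype.card ι - wt p.1 : ℕ) : ℝ) * ((Fintype.card ι).choose (wt p.1) : ℝ))

/-- Statement of STUB 2 (binomial hazard estimate at the matched density `q = j/N`). [folklore] -/
def BinomialHazardStmt : Prop :=
  ∃ K₀ : ℝ, 0 < K₀ ∧ ∀ (N j i : ℕ), 0 < j → j < N → i < N →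
    hybridWeight N ((j : ℝ) / N) j i / (((N - i : ℕ) : ℝ) * (N.choose i : ℝ)) ≤
      K₀ / Real.sqrt j * (((j : ℝ) / N) ^ (i + 1) * (1 - (j : ℝ) / N) ^ (N - 1 - i))

/-- Statement of STUB 3 (AND-coin identity: biased influence = average of unbiased influences of random
0-restrictions). [folklore] -/
def AndCoinStmt : Prop :=
  ∀ (ι : Type) [Fintype ι] [DecidableEq ι] (f : (ι → Bool) → Bool) (q : ℝ), 0 ≤ q → 2 * q ≤ 1 →
    2 * q * biasedInfluence q f =
      ∑ y : ι → Bool, prodWeight (2 * q) y * biasedInfluence (1 / 2) (fun z => f (fun i => y i && z i))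

/-- Boppana's bound (total influence of bounded-depth `acBasis` circuits is polylog in the size, uniformly in the
number of inputs) — no longer a stub: PROVED below (`boppana_of`) from STUB 4a + STUB 4b + the index transport. [folklore] -/
def BoppanaStmt : Prop :=
  ∀ d : ℕ, ∃ K : ℝ, ∃ B : ℕ, ∀ (ι : Type) [Fintype ι] [DecidableEq ι] (C : Circuit ι),
    C.IsOver acBasis → C.acDepth ≤ d →
      biasedInfluence (1 / 2) C.eval ≤ K * Real.log ((C.size : ℝ) + 2) ^ B

/-- Statement of STUB 4a (Fourier formula for the total influence on `{0,1}^m`: `I[f] = Σ_{k=1}^{m} W^{≥k}[sgn ∘ f]`,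
i.e. `Σ_S |S| f̂(S)²`, in the tree's `cubeFourierCoeff`/`tailWeight` normalisation; the left side is
`biasedInfluence (1/2) f` unfolded). [folklore] -/
def InfluenceFourierStmt : Prop :=
  ∀ (m : ℕ) (f : (Fin m → Bool) → Bool),
    (∑ p ∈ (univ.filter fun p : (Fin m → Bool) × Fin m =>
        p.1 p.2 = false ∧ f p.1 ≠ f (Function.update p.1 p.2 true)),
      (1 / 2 : ℝ) ^ #(univ.filter fun i => p.1 i = true) *
        (1 - 1 / 2 : ℝ) ^ (Fintype.card (Fin m) - 1 - #(univ.filter fun i => p.1 i = true))) =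
    ∑ k ∈ Finset.Icc 1 m, tailWeight (fun x => sgn (f x)) k

/-- Statement of STUB 4b (Tal/LMN/Boppana: the summed Fourier tails `Σ_{k=1}^{m} W^{≥k}` of an `acBasis` circuit of
`acDepth ≤ d` on `Fin m` are at most `K_d (log(|C|+2))^{B_d}`). [folklore] -/
def TalInfluenceStmt : Prop :=
  ∀ d : ℕ, ∃ K : ℝ, ∃ B : ℕ, ∀ (m : ℕ) (C : Circuit (Fin m)), C.IsOver acBasis → C.acDepth ≤ d →
    ∑ k ∈ Finset.Icc 1 m, tailWeight (fun x => sgn (C.eval x)) k ≤ K * Real.log ((C.size : ℝ) + 2) ^ B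

/-- **C⁺ of the line (`Transfer`)** — slice/product indistinguishability for small bounded-depth circuits on ANY
finite cube: for `j ≥ j₀(d,c,ε)` and `2j ≤ N`, an `acBasis` circuit of `acDepth ≤ d` with `≤ j^c` gates accepts
the uniform point of slice `j` and the `μ_{j/N}`-random point with probabilities within `ε`. CLIQUE, `k`, `δ` and
`Hyp` are gone; rate `polylog(j)/√j` (`sliceIndist_of`). [folklore] -/
def SliceIndist : Prop :=
  ∀ (d c : ℕ) (ε : ℝ), 0 < ε → ∃ j₀ : ℕ, ∀ (ι : Type) [Fintype ι] [DecidableEq ι] (j : ℕ),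
    j₀ ≤ j → 2 * j ≤ Fintype.card ι →
      ∀ C : Circuit ι, C.IsOver acBasis → C.acDepth ≤ d → C.size ≤ j ^ c →
        |prodAvg ((j : ℝ) / (Fintype.card ι : ℝ)) C.eval - sliceAvg C.eval j| ≤ ε

/-! ### Read-back of the crux in the vocabulary of `Cruxes/SliceACZero/Disproof.lean` (definitional) -/

/-- `m_k(n) = ⌊C(n,2) · n^{-2/(k-1)}⌋₊`, the critical edge count (as in the Disproof). [folklore] -/
def mk (n k : ℕ) : ℕ := ⌊((n.choose 2 : ℕ) : ℝ) * (n : ℝ) ^ (-(2 : ℝ) / ((k : ℝ) - 1))⌋₊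

/-- Size of the slice `G(n,j)` (as in the Disproof; `= C(C(n,2), j)`). [folklore] -/
def sliceCard (n j : ℕ) : ℕ :=
  #(univ.filter fun x : (⊤ : SimpleGraph (Fin n)).edgeSet → Bool => edgeCount x = j)

/-- Number of `j`-edge vectors on which `f` and `g` disagree (as in the Disproof). [folklore] -/
def sliceErr (n j : ℕ) (f g : ((⊤ : SimpleGraph (Fin n)).edgeSet → Bool) → Bool) : ℕ :=
  #(univ.filter fun x : (⊤ : SimpleGraph (Fin n)).edgeSet → Bool => edgeCount x = j ∧ f x ≠ g x)

/-- `Hyp`, the hypothesis of the crux: the fixed-δ, window-uniform, single-threshold average-case AC⁰ lower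
bound for `k`-CLIQUE on `G(n,q)` (Rossman 2008 strength), read back with `gnpDisagreeProb`/`cliqueFn`. [folklore] -/
def CruxHyp : Prop :=
  ∀ d c : ℕ, ∃ k : ℕ, 3 ≤ k ∧ ∃ δ : ℝ, 0 < δ ∧ ∀ᶠ n : ℕ in atTop, ∀ q : ℝ, 0 ≤ q → q ≤ 1 →
    |q * (n.choose 2 : ℕ) - (mk n k : ℝ)| ≤ (mk n k : ℝ) ^ ((3 : ℝ) / 4) →
    ∀ C : Circuit ((⊤ : SimpleGraph (Fin n)).edgeSet), C.IsOver acBasis → C.acDepth ≤ d →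
      gnpDisagreeProb n q C.eval (cliqueFn n k) ≤ δ → n ^ c < C.size

/-- `Conc`, the conclusion of the crux: the same bound on every central slice `G(n,j)`. [folklore] -/
def CruxConc : Prop :=
  ∀ d c : ℕ, ∃ k : ℕ, 3 ≤ k ∧ ∃ δ : ℝ, 0 < δ ∧ ∀ᶠ n : ℕ in atTop, ∀ j : ℕ,
    |(j : ℝ) - (mk n k : ℝ)| ≤ (mk n k : ℝ) ^ ((3 : ℝ) / 4) →
    ∀ C : Circuit ((⊤ : SimpleGraph (Fin n)).edgeSet), C.IsOver acBasis → C.acDepth ≤ d →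
      (sliceErr n j C.eval (cliqueFn n k) : ℝ) ≤ δ * sliceCard n j → n ^ c < C.size

/-- **Read-back.** The crux is literally `CruxHyp → CruxConc` (definitional unfolding of the route decl; same
read-back as the Disproof's `sliceACZero_iff`). [folklore] -/
theorem sliceACZero_iff : SliceACZero ↔ (CruxHyp → CruxConc) := Iff.rfl



/-! ### drefute gen-3: kernel-checked proofs of the five stubs (sub-namespaces `S1` … `S4b`) -/

namespace S1


open Finset





section Counting

variable {ι : Type} [Fintype ι] [DecidableEq ι]

omit [DecidableEq ι] in
/-- `|x| ≤ N`. [folklore] -/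
theorem wt_le (x : ι → Bool) : wt x ≤ Fintype.card ι := by
  rw [wt, ← Finset.card_univ]; exact Finset.card_le_card (Finset.filter_subset _ _)

omit [DecidableEq ι] in
/-- `#{i : x_i = 0} = N − |x|`. [folklore] -/
theorem card_false_eq (x : ι → Bool) : #(univ.filter fun i => x i = false) = Fintype.card ι - wt x := by
  have h := Finset.card_filter_add_card_filter_not (s := (univ : Finset ι)) (fun i => x i = true)
  rw [Finset.card_univ] at h
  have e : (univ.filter fun i => ¬ x i = true) = univ.filter fun i => x i = false := by
    ext i; simp
  rw [e] at h
  rw [wt]; omega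

/-- Switching a `0` to `1` raises the weight by one. [folklore] -/
theorem wt_update_true {x : ι → Bool} {i : ι} (hi : x i = false) :
    wt (Function.update x i true) = wt x + 1 := by
  unfold wt
  have e : (univ.filter fun k => Function.update x i true k = true) = insert i (univ.filter fun k => x k = true) := by
    ext k
    by_cases hk : k = i
    · subst hk; simp
    · simp [hk]
  rw [e, Finset.card_insert_of_notMem]
  simp [hi]

/-- Switching a `1` to `0` lowers the weight by one. [folklore] -/
theorem wt_update_false {y : ι → Bool} {i : ι} (hi : y i = true) :
    wt (Function.update y i false) + 1 = wt y := by
  have h1 : Function.update y i false i = false := by simp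
  have h2 : Function.update (Function.update y i false) i true = y := by
    rw [Function.update_idem, ← hi, Function.update_eq_self]
  rw [← wt_update_true h1, h2]

/-- **The slice has `C(N,ℓ)` points.** [folklore] -/
theorem card_level (ℓ : ℕ) : #(univ.filter fun x : ι → Bool => wt x = ℓ) = (Fintype.card ι).choose ℓ := by
  rw [← Finset.card_univ, ← Finset.card_powersetCard ℓ (univ : Finset ι)]
  refine Finset.card_bij' (fun x _ => univ.filter fun i => x i = true) (fun S _ => fun i => decide (i ∈ S))
    ?_ ?_ ?_ ?_
  · intro x hx
    simp only [Finset.mem_filter, Finset.mem_univ, true_and] at hx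
    rw [Finset.mem_powersetCard]
    exact ⟨Finset.filter_subset _ _, hx⟩
  · intro S hS
    rw [Finset.mem_powersetCard] at hS
    simp only [Finset.mem_filter, Finset.mem_univ, true_and, wt]
    have : (univ.filter fun i => decide (i ∈ S) = true) = S := by ext i; simp
    rw [this]; exact hS.2
  · intro x hx; funext i; cases h : x i <;> simp [h]
  · intro S hS; ext i; simp

/-- Count of points of slice `ℓ` where `f = 1`. [folklore] -/
def levelCount (f : (ι → Bool) → Bool) (ℓ : ℕ) : ℕ := #(univ.filter fun x : ι → Bool => wt x = ℓ ∧ f x = true)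

/-- The pivotal up-edges from level `ℓ`. [folklore] -/
def betaSet (f : (ι → Bool) → Bool) (ℓ : ℕ) : Finset ((ι → Bool) × ι) := (upPivotal f).filter fun p => wt p.1 = ℓ

/-- Up-edges from level `ℓ` with `f(bottom) = 1`: `(N − ℓ)·m_ℓ` of them. [folklore] -/
theorem card_up_bottom (f : (ι → Bool) → Bool) (ℓ : ℕ) :
    #(univ.filter fun p : (ι → Bool) × ι => wt p.1 = ℓ ∧ p.1 p.2 = false ∧ f p.1 = true) =
      (Fintype.card ι - ℓ) * levelCount f ℓ := by
  rw [Finset.card_filter, Fintype.sum_prod_type]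
  have e : ∀ x : ι → Bool, (∑ i : ι, if wt x = ℓ ∧ x i = false ∧ f x = true then 1 else 0) =
      if wt x = ℓ ∧ f x = true then Fintype.card ι - ℓ else 0 := by
    intro x
    by_cases h : wt x = ℓ ∧ f x = true
    · rw [if_pos h, ← h.1, ← card_false_eq x, Finset.card_filter]
      refine Finset.sum_congr rfl fun i _ => ?_
      simp [h.1, h.2]
    · rw [if_neg h]
      refine Finset.sum_eq_zero fun i _ => ?_
      rw [if_neg]
      exact fun h' => h ⟨h'.1, h'.2.2⟩
  simp_rw [e]
  rw [← Finset.sum_filter, Finset.sum_const, smul_eq_mul, mul_comm]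
  rfl

/-- Down-edges into level `ℓ+1` with `f(top) = 1`: `(ℓ+1)·m_{ℓ+1}` of them. [folklore] -/
theorem card_down_top (f : (ι → Bool) → Bool) (ℓ : ℕ) :
    #(univ.filter fun p : (ι → Bool) × ι => wt p.1 = ℓ + 1 ∧ p.1 p.2 = true ∧ f p.1 = true) =
      (ℓ + 1) * levelCount f (ℓ + 1) := by
  rw [Finset.card_filter, Fintype.sum_prod_type]
  have e : ∀ y : ι → Bool, (∑ i : ι, if wt y = ℓ + 1 ∧ y i = true ∧ f y = true then 1 else 0) =
      if wt y = ℓ + 1 ∧ f y = true then ℓ + 1 else 0 := by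
    intro y
    by_cases h : wt y = ℓ + 1 ∧ f y = true
    · rw [if_pos h, ← h.1, wt, Finset.card_filter]
      refine Finset.sum_congr rfl fun i _ => ?_
      simp [h.1, h.2]
    · rw [if_neg h]
      refine Finset.sum_eq_zero fun i _ => ?_
      rw [if_neg]
      exact fun h' => h ⟨h'.1, h'.2.2⟩
  simp_rw [e]
  rw [← Finset.sum_filter, Finset.sum_const, smul_eq_mul, mul_comm]
  rfl

/-- Up-edges from level `ℓ` with `f(top) = 1` ARE the down-edges into level `ℓ+1` with `f(top) = 1`. [folklore] -/
theorem card_up_top (f : (ι → Bool) → Bool) (ℓ : ℕ) :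
    #(univ.filter fun p : (ι → Bool) × ι => wt p.1 = ℓ ∧ p.1 p.2 = false ∧ f (Function.update p.1 p.2 true) = true) =
      #(univ.filter fun p : (ι → Bool) × ι => wt p.1 = ℓ + 1 ∧ p.1 p.2 = true ∧ f p.1 = true) := by
  refine Finset.card_bij' (fun p _ => (Function.update p.1 p.2 true, p.2))
    (fun p _ => (Function.update p.1 p.2 false, p.2)) ?_ ?_ ?_ ?_
  · intro p hp
    simp only [Finset.mem_filter, Finset.mem_univ, true_and] at hp ⊢
    exact ⟨by rw [wt_update_true hp.2.1, hp.1], by simp, hp.2.2⟩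
  · intro p hp
    simp only [Finset.mem_filter, Finset.mem_univ, true_and] at hp ⊢
    have h2 : Function.update (Function.update p.1 p.2 false) p.2 true = p.1 := by
      rw [Function.update_idem, ← hp.2.1, Function.update_eq_self]
    refine ⟨?_, by simp, by rw [h2]; exact hp.2.2⟩
    have := wt_update_false hp.2.1
    omega
  · intro p hp
    simp only [Finset.mem_filter, Finset.mem_univ, true_and] at hp
    ext
    · simp only
      rw [Function.update_idem, ← hp.2.1, Function.update_eq_self]
    · rfl
  · intro p hp
    simp only [Finset.mem_filter, Finset.mem_univ, true_and] at hp
    ext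
    · simp only
      rw [Function.update_idem, ← hp.2.1, Function.update_eq_self]
    · rfl

/-- **The edge inequality**: `|(ℓ+1)·m_{ℓ+1} − (N−ℓ)·m_ℓ| ≤ β_ℓ`. [folklore] -/
theorem abs_level_step_le (f : (ι → Bool) → Bool) (ℓ : ℕ) :
    |((ℓ : ℝ) + 1) * (levelCount f (ℓ + 1) : ℝ) - ((Fintype.card ι - ℓ : ℕ) : ℝ) * (levelCount f ℓ : ℝ)| ≤
      #(betaSet f ℓ) := by
  classical
  set T := univ.filter fun p : (ι → Bool) × ι =>
    wt p.1 = ℓ ∧ p.1 p.2 = false ∧ f (Function.update p.1 p.2 true) = true with hT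
  set S := univ.filter fun p : (ι → Bool) × ι => wt p.1 = ℓ ∧ p.1 p.2 = false ∧ f p.1 = true with hS
  set C := univ.filter fun p : (ι → Bool) × ι =>
    wt p.1 = ℓ ∧ p.1 p.2 = false ∧ f p.1 = true ∧ f (Function.update p.1 p.2 true) = true with hC
  have hTcard : #T = (ℓ + 1) * levelCount f (ℓ + 1) := by rw [hT, card_up_top, card_down_top]
  have hScard : #S = (Fintype.card ι - ℓ) * levelCount f ℓ := by rw [hS, card_up_bottom]
  have hmemβ : ∀ p : (ι → Bool) × ι, p ∈ betaSet f ℓ ↔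
      wt p.1 = ℓ ∧ p.1 p.2 = false ∧ f p.1 ≠ f (Function.update p.1 p.2 true) := by
    intro p
    simp only [betaSet, upPivotal, Finset.mem_filter, Finset.mem_univ, true_and]
    tauto
  have hCT : C ⊆ T := by
    intro p hp
    simp only [hC, hT, Finset.mem_filter, Finset.mem_univ, true_and] at hp ⊢
    exact ⟨hp.1, hp.2.1, hp.2.2.2⟩
  have hCS : C ⊆ S := by
    intro p hp
    simp only [hC, hS, Finset.mem_filter, Finset.mem_univ, true_and] at hp ⊢
    exact ⟨hp.1, hp.2.1, hp.2.2.1⟩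
  have hTC : T ⊆ C ∪ betaSet f ℓ := by
    intro p hp
    simp only [hT, Finset.mem_filter, Finset.mem_univ, true_and] at hp
    rw [Finset.mem_union, hmemβ]
    by_cases hfx : f p.1 = true
    · left
      simp only [hC, Finset.mem_filter, Finset.mem_univ, true_and]
      exact ⟨hp.1, hp.2.1, hfx, hp.2.2⟩
    · right
      exact ⟨hp.1, hp.2.1, by rw [hp.2.2]; exact hfx⟩
  have hSC : S ⊆ C ∪ betaSet f ℓ := by
    intro p hp
    simp only [hS, Finset.mem_filter, Finset.mem_univ, true_and] at hp
    rw [Finset.mem_union, hmemβ]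
    by_cases hft : f (Function.update p.1 p.2 true) = true
    · left
      simp only [hC, Finset.mem_filter, Finset.mem_univ, true_and]
      exact ⟨hp.1, hp.2.1, hp.2.2, hft⟩
    · right
      exact ⟨hp.1, hp.2.1, by rw [hp.2.2]; exact Ne.symm hft⟩
  have h1 : #C ≤ #T := Finset.card_le_card hCT
  have h2 : #C ≤ #S := Finset.card_le_card hCS
  have h3 : #T ≤ #C + #(betaSet f ℓ) := (Finset.card_le_card hTC).trans (Finset.card_union_le _ _)
  have h4 : #S ≤ #C + #(betaSet f ℓ) := (Finset.card_le_card hSC).trans (Finset.card_union_le _ _)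
  have hTr : ((ℓ : ℝ) + 1) * (levelCount f (ℓ + 1) : ℝ) = (#T : ℝ) := by rw [hTcard]; push_cast; ring
  have hSr : ((Fintype.card ι - ℓ : ℕ) : ℝ) * (levelCount f ℓ : ℝ) = (#S : ℝ) := by rw [hScard]; push_cast; ring
  rw [hTr, hSr, abs_sub_le_iff]
  constructor
  · have : (#T : ℝ) ≤ (#C : ℝ) + #(betaSet f ℓ) := by exact_mod_cast h3
    have : (#C : ℝ) ≤ #S := by exact_mod_cast h2
    linarith
  · have : (#S : ℝ) ≤ (#C : ℝ) + #(betaSet f ℓ) := by exact_mod_cast h4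
    have : (#C : ℝ) ≤ #T := by exact_mod_cast h1
    linarith

end Counting

section Assembly

variable {ι : Type} [Fintype ι] [DecidableEq ι]

/-- A pivotal bottom point has weight `< N` (as in the skeleton). [folklore] -/
theorem wt_lt_card_of_mem_upPivotal {f : (ι → Bool) → Bool} {p : (ι → Bool) × ι}
    (hp : p ∈ upPivotal f) : wt p.1 < Fintype.card ι := by
  rw [upPivotal, mem_filter] at hp
  rw [wt, ← Finset.card_univ (α := ι)]
  refine Finset.card_lt_card (Finset.filter_ssubset.2 ⟨p.2, mem_univ _, ?_⟩)
  rw [hp.2.1]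
  exact Bool.false_ne_true

/-- `a_ℓ = m_ℓ / C(N,ℓ)`. [folklore] -/
theorem sliceAvg_eq (f : (ι → Bool) → Bool) (ℓ : ℕ) :
    sliceAvg f ℓ = (levelCount f ℓ : ℝ) / ((Fintype.card ι).choose ℓ : ℝ) := by
  rw [sliceAvg, card_level]; rfl

/-- **The up-step coupling**: `|a_{ℓ+1} − a_ℓ| ≤ β_ℓ/((N−ℓ)C(N,ℓ))` for `ℓ < N`. [folklore] -/
theorem abs_sliceAvg_step_le (f : (ι → Bool) → Bool) {ℓ : ℕ} (hℓ : ℓ < Fintype.card ι) :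
    |sliceAvg f (ℓ + 1) - sliceAvg f ℓ| ≤
      #(betaSet f ℓ) / (((Fintype.card ι - ℓ : ℕ) : ℝ) * ((Fintype.card ι).choose ℓ : ℝ)) := by
  have hc1 : (0 : ℝ) < ((Fintype.card ι).choose (ℓ + 1) : ℝ) := by exact_mod_cast Nat.choose_pos hℓ
  have hc0 : (0 : ℝ) < ((Fintype.card ι).choose ℓ : ℝ) := by exact_mod_cast Nat.choose_pos hℓ.le
  have hNl : (0 : ℝ) < ((Fintype.card ι - ℓ : ℕ) : ℝ) := by exact_mod_cast (by omega : 0 < Fintype.card ι - ℓ)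
  have hD : 0 < ((Fintype.card ι - ℓ : ℕ) : ℝ) * ((Fintype.card ι).choose ℓ : ℝ) := mul_pos hNl hc0
  have hchoose : (((Fintype.card ι).choose (ℓ + 1) : ℕ) : ℝ) * ((ℓ : ℝ) + 1) =
      ((Fintype.card ι).choose ℓ : ℝ) * ((Fintype.card ι - ℓ : ℕ) : ℝ) := by
    exact_mod_cast Nat.choose_succ_right_eq (Fintype.card ι) ℓ
  rw [sliceAvg_eq, sliceAvg_eq, le_div_iff₀ hD]
  have key := abs_level_step_le f ℓ
  have e : |(levelCount f (ℓ + 1) : ℝ) / ((Fintype.card ι).choose (ℓ + 1) : ℝ) -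
        (levelCount f ℓ : ℝ) / ((Fintype.card ι).choose ℓ : ℝ)| *
        (((Fintype.card ι - ℓ : ℕ) : ℝ) * ((Fintype.card ι).choose ℓ : ℝ)) =
      |((ℓ : ℝ) + 1) * (levelCount f (ℓ + 1) : ℝ) -
        ((Fintype.card ι - ℓ : ℕ) : ℝ) * (levelCount f ℓ : ℝ)| := by
    rw [← abs_of_pos hD, ← abs_mul]
    congr 1
    rw [div_sub_div _ _ hc1.ne' hc0.ne', div_mul_eq_mul_div, div_eq_iff (mul_ne_zero hc1.ne' hc0.ne')]
    linear_combination (-((levelCount f (ℓ + 1) : ℝ) * ((Fintype.card ι).choose ℓ : ℝ))) * hchoose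
  rw [e]
  exact key

/-- Telescoping upwards from `j`. [folklore] -/
theorem abs_sliceAvg_sub_le_of_le (f : (ι → Bool) → Bool) {j ℓ : ℕ} (hjℓ : j ≤ ℓ) (hℓ : ℓ ≤ Fintype.card ι) :
    |sliceAvg f ℓ - sliceAvg f j| ≤
      ∑ i ∈ Finset.Ico j ℓ, #(betaSet f i) / (((Fintype.card ι - i : ℕ) : ℝ) * ((Fintype.card ι).choose i : ℝ)) := by
  induction ℓ, hjℓ using Nat.le_induction with
  | base => simp
  | succ ℓ hjℓ ih =>
    have ih' := ih (by omega)
    rw [Finset.sum_Ico_succ_top hjℓ]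
    calc |sliceAvg f (ℓ + 1) - sliceAvg f j|
        = |(sliceAvg f (ℓ + 1) - sliceAvg f ℓ) + (sliceAvg f ℓ - sliceAvg f j)| := by ring_nf
      _ ≤ |sliceAvg f (ℓ + 1) - sliceAvg f ℓ| + |sliceAvg f ℓ - sliceAvg f j| := abs_add_le _ _
      _ ≤ #(betaSet f ℓ) / (((Fintype.card ι - ℓ : ℕ) : ℝ) * ((Fintype.card ι).choose ℓ : ℝ)) +
            ∑ i ∈ Finset.Ico j ℓ, #(betaSet f i) / (((Fintype.card ι - i : ℕ) : ℝ) * ((Fintype.card ι).choose i : ℝ)) :=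
          add_le_add (abs_sliceAvg_step_le f (by omega)) ih'
      _ = _ := add_comm _ _

/-- Telescoping between `j` and `ℓ`. [folklore] -/
theorem abs_sliceAvg_sub_le (f : (ι → Bool) → Bool) {j ℓ : ℕ} (hj : j ≤ Fintype.card ι) (hℓ : ℓ ≤ Fintype.card ι) :
    |sliceAvg f ℓ - sliceAvg f j| ≤
      ∑ i ∈ Finset.Ico (min ℓ j) (max ℓ j),
        #(betaSet f i) / (((Fintype.card ι - i : ℕ) : ℝ) * ((Fintype.card ι).choose i : ℝ)) := by
  rcases le_total j ℓ with h | h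
  · rw [min_eq_right h, max_eq_left h]; exact abs_sliceAvg_sub_le_of_le f h hℓ
  · rw [min_eq_left h, max_eq_right h, abs_sub_comm]; exact abs_sliceAvg_sub_le_of_le f h hj

/-- **Level decomposition** `E_{μ_q} f = Σ_ℓ B(ℓ) a_ℓ`. [folklore] -/
theorem prodAvg_eq (q : ℝ) (f : (ι → Bool) → Bool) :
    prodAvg q f = ∑ ℓ ∈ Finset.range (Fintype.card ι + 1), binomPMF (Fintype.card ι) q ℓ * sliceAvg f ℓ := by
  unfold prodAvg
  rw [← Finset.sum_fiberwise_of_maps_to (g := fun x : ι → Bool => wt x) (t := Finset.range (Fintype.card ι + 1))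
    (fun x _ => by rw [Finset.mem_range]; exact Nat.lt_succ_of_le (wt_le x))]
  refine Finset.sum_congr rfl fun ℓ hℓ => ?_
  rw [Finset.mem_range] at hℓ
  have e : ∀ x ∈ (univ.filter fun x : ι → Bool => f x = true).filter (fun x => wt x = ℓ),
      prodWeight q x = q ^ ℓ * (1 - q) ^ (Fintype.card ι - ℓ) := by
    intro x hx
    simp only [Finset.mem_filter, Finset.mem_univ, true_and] at hx
    rw [prodWeight, hx.2]
  rw [Finset.sum_congr rfl e, Finset.sum_const, nsmul_eq_mul]
  have hc : #((univ.filter fun x : ι → Bool => f x = true).filter (fun x => wt x = ℓ)) = levelCount f ℓ := by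
    rw [levelCount, Finset.filter_filter, Finset.filter_congr (fun x _ => and_comm)]
  have hc0 : (0 : ℝ) < ((Fintype.card ι).choose ℓ : ℝ) := by exact_mod_cast Nat.choose_pos (by omega)
  rw [hc, sliceAvg_eq, binomPMF, mul_div_assoc', eq_div_iff hc0.ne']
  ring

/-- Total binomial mass. [folklore] -/
theorem sum_binomPMF (N : ℕ) (q : ℝ) : ∑ ℓ ∈ Finset.range (N + 1), binomPMF N q ℓ = 1 := by
  have h := (add_pow q (1 - q) N).symm
  rw [add_sub_cancel, one_pow] at h
  rw [← h]
  refine Finset.sum_congr rfl fun ℓ _ => ?_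
  unfold binomPMF; ring

theorem binomPMF_nonneg {q : ℝ} (hq0 : 0 ≤ q) (hq1 : q ≤ 1) (N ℓ : ℕ) : 0 ≤ binomPMF N q ℓ := by
  unfold binomPMF
  exact mul_nonneg (mul_nonneg (Nat.cast_nonneg _) (pow_nonneg hq0 _)) (pow_nonneg (by linarith) _)

/-- **Exchange of summation**: level `i` is charged exactly `hybridWeight N q j i`. [folklore] -/
theorem exchange (N j : ℕ) (hj : j ≤ N) (q : ℝ) (δ : ℕ → ℝ) :
    ∑ ℓ ∈ Finset.range (N + 1), binomPMF N q ℓ * ∑ i ∈ Finset.Ico (min ℓ j) (max ℓ j), δ i =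
      ∑ i ∈ Finset.range N, hybridWeight N q j i * δ i := by
  have inner : ∀ ℓ ∈ Finset.range (N + 1), binomPMF N q ℓ * ∑ i ∈ Finset.Ico (min ℓ j) (max ℓ j), δ i =
      ∑ i ∈ Finset.range N, if (min ℓ j ≤ i ∧ i < max ℓ j) then binomPMF N q ℓ * δ i else 0 := by
    intro ℓ hℓ
    rw [Finset.mem_range] at hℓ
    rw [Finset.mul_sum, ← Finset.sum_filter]
    congr 1
    ext i
    simp only [Finset.mem_Ico, Finset.mem_filter, Finset.mem_range, min_le_iff, lt_max_iff]
    omega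
  rw [Finset.sum_congr rfl inner, Finset.sum_comm]
  refine Finset.sum_congr rfl fun i hi => ?_
  rw [Finset.mem_range] at hi
  rw [← Finset.sum_filter, ← Finset.sum_mul]
  congr 1
  unfold hybridWeight
  split_ifs with hji
  · congr 1
    ext ℓ
    simp only [Finset.mem_filter, Finset.mem_range, Finset.mem_Ioc, min_le_iff, lt_max_iff]
    omega
  · congr 1
    ext ℓ
    simp only [Finset.mem_filter, Finset.mem_range, min_le_iff, lt_max_iff]
    omega

/-- **Regrouping the right-hand side by level.** [folklore] -/
theorem rhs_regroup (f : (ι → Bool) → Bool) (q : ℝ) (j : ℕ) :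
    ∑ p ∈ upPivotal f, hybridWeight (Fintype.card ι) q j (wt p.1) /
        (((Fintype.card ι - wt p.1 : ℕ) : ℝ) * ((Fintype.card ι).choose (wt p.1) : ℝ)) =
      ∑ i ∈ Finset.range (Fintype.card ι), hybridWeight (Fintype.card ι) q j i *
        (#(betaSet f i) / (((Fintype.card ι - i : ℕ) : ℝ) * ((Fintype.card ι).choose i : ℝ))) := by
  rw [← Finset.sum_fiberwise_of_maps_to (s := upPivotal f) (t := Finset.range (Fintype.card ι))
    (g := fun p : (ι → Bool) × ι => wt p.1)
    (fun p hp => by rw [Finset.mem_range]; exact wt_lt_card_of_mem_upPivotal hp)]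
  refine Finset.sum_congr rfl fun i hi => ?_
  have e : ∀ p ∈ (upPivotal f).filter (fun p : (ι → Bool) × ι => wt p.1 = i),
      hybridWeight (Fintype.card ι) q j (wt p.1) /
          (((Fintype.card ι - wt p.1 : ℕ) : ℝ) * ((Fintype.card ι).choose (wt p.1) : ℝ)) =
        hybridWeight (Fintype.card ι) q j i / (((Fintype.card ι - i : ℕ) : ℝ) * ((Fintype.card ι).choose i : ℝ)) := by
    intro p hp
    rw [(Finset.mem_filter.1 hp).2]
  rw [Finset.sum_congr rfl e, Finset.sum_const, nsmul_eq_mul, betaSet]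
  ring

end Assembly

/-- **Stub 1 (`SliceCouplingStmt`) proved.** [folklore] -/
theorem sliceCoupling :
    ∀ (ι : Type) [Fintype ι] [DecidableEq ι] (f : (ι → Bool) → Bool) (q : ℝ), 0 ≤ q → q ≤ 1 →
      ∀ j : ℕ, j ≤ Fintype.card ι →
        |prodAvg q f - sliceAvg f j| ≤
          ∑ p ∈ upPivotal f, hybridWeight (Fintype.card ι) q j (wt p.1) /
            (((Fintype.card ι - wt p.1 : ℕ) : ℝ) * ((Fintype.card ι).choose (wt p.1) : ℝ)) := by
  intro ι _ _ f q hq0 hq1 j hj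
  have hB0 : ∀ ℓ, 0 ≤ binomPMF (Fintype.card ι) q ℓ := binomPMF_nonneg hq0 hq1 _
  have hsum1 := sum_binomPMF (Fintype.card ι) q
  rw [rhs_regroup f q j, ← exchange (Fintype.card ι) j hj q]
  calc |prodAvg q f - sliceAvg f j|
      = |∑ ℓ ∈ Finset.range (Fintype.card ι + 1),
          binomPMF (Fintype.card ι) q ℓ * (sliceAvg f ℓ - sliceAvg f j)| := by
        rw [prodAvg_eq]
        congr 1
        simp_rw [mul_sub]
        rw [Finset.sum_sub_distrib, ← Finset.sum_mul, hsum1, one_mul]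
    _ ≤ ∑ ℓ ∈ Finset.range (Fintype.card ι + 1),
          |binomPMF (Fintype.card ι) q ℓ * (sliceAvg f ℓ - sliceAvg f j)| := Finset.abs_sum_le_sum_abs _ _
    _ = ∑ ℓ ∈ Finset.range (Fintype.card ι + 1),
          binomPMF (Fintype.card ι) q ℓ * |sliceAvg f ℓ - sliceAvg f j| :=
        Finset.sum_congr rfl fun ℓ _ => by rw [abs_mul, abs_of_nonneg (hB0 ℓ)]
    _ ≤ ∑ ℓ ∈ Finset.range (Fintype.card ι + 1), binomPMF (Fintype.card ι) q ℓ *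
          ∑ i ∈ Finset.Ico (min ℓ j) (max ℓ j),
            #(betaSet f i) / (((Fintype.card ι - i : ℕ) : ℝ) * ((Fintype.card ι).choose i : ℝ)) :=
        Finset.sum_le_sum fun ℓ hℓ =>
          mul_le_mul_of_nonneg_left
            (abs_sliceAvg_sub_le f hj (by rw [Finset.mem_range] at hℓ; omega)) (hB0 ℓ)


end S1

namespace S2


open Finset



/-- The successive ratio `r(ℓ) = (N−ℓ)q/((ℓ+1)(1−q))` (real subtraction). [folklore] -/
def ratio (N : ℕ) (q : ℝ) (ℓ : ℕ) : ℝ := ((N : ℝ) - ℓ) * q / (((ℓ : ℝ) + 1) * (1 - q))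

section Basic

variable {N : ℕ} {q : ℝ}

theorem binomPMF_nonneg (hq0 : 0 ≤ q) (hq1 : q ≤ 1) (ℓ : ℕ) : 0 ≤ binomPMF N q ℓ := by
  unfold binomPMF
  exact mul_nonneg (mul_nonneg (Nat.cast_nonneg _) (pow_nonneg hq0 _)) (pow_nonneg (by linarith) _)

theorem binomPMF_pos (hq0 : 0 < q) (hq1 : q < 1) {ℓ : ℕ} (hℓ : ℓ ≤ N) : 0 < binomPMF N q ℓ := by
  unfold binomPMF
  have : 0 < (N.choose ℓ : ℝ) := by exact_mod_cast Nat.choose_pos hℓ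
  exact mul_pos (mul_pos this (pow_pos hq0 _)) (pow_pos (by linarith) _)

theorem binomPMF_eq_zero_of_lt {ℓ : ℕ} (hℓ : N < ℓ) : binomPMF N q ℓ = 0 := by
  unfold binomPMF
  rw [Nat.choose_eq_zero_of_lt hℓ]
  simp

/-- **Ratio identity** `B(ℓ+1) = r(ℓ)·B(ℓ)` (all `ℓ`, `q ≠ 1`). [folklore] -/
theorem binomPMF_succ (hq1 : q ≠ 1) (ℓ : ℕ) : binomPMF N q (ℓ + 1) = ratio N q ℓ * binomPMF N q ℓ := by
  have h1q : (1 - q) ≠ 0 := sub_ne_zero.2 (Ne.symm hq1)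
  rcases lt_or_ge ℓ N with hℓ | hℓ
  · unfold binomPMF ratio
    have hc : ((N.choose (ℓ + 1) : ℕ) : ℝ) * ((ℓ : ℝ) + 1) = (N.choose ℓ : ℝ) * ((N : ℝ) - ℓ) := by
      have := Nat.choose_succ_right_eq N ℓ
      have h' : ((N.choose (ℓ + 1) * (ℓ + 1) : ℕ) : ℝ) = ((N.choose ℓ * (N - ℓ) : ℕ) : ℝ) := by
        exact_mod_cast this
      push_cast [Nat.cast_sub hℓ.le] at h'
      linarith
    have hpow : (1 - q) ^ (N - ℓ) = (1 - q) ^ (N - (ℓ + 1)) * (1 - q) := by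
      rw [← pow_succ]; congr 1; omega
    have hℓ1 : (ℓ : ℝ) + 1 ≠ 0 := by positivity
    rw [hpow, pow_succ, div_mul_eq_mul_div, eq_div_iff (mul_ne_zero hℓ1 h1q)]
    linear_combination (q ^ ℓ * q * (1 - q) ^ (N - (ℓ + 1)) * (1 - q)) * hc
  · rw [binomPMF_eq_zero_of_lt (by omega)]
    rcases hℓ.eq_or_lt with rfl | hlt
    · unfold ratio; simp
    · rw [binomPMF_eq_zero_of_lt hlt]; simp

/-- The ratio is antitone in `ℓ` (for `0 ≤ q < 1`). [folklore] -/
theorem ratio_antitone (hq0 : 0 ≤ q) (hq1 : q < 1) {ℓ ℓ' : ℕ} (h : ℓ ≤ ℓ') : ratio N q ℓ' ≤ ratio N q ℓ := by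
  unfold ratio
  have h1q : 0 < 1 - q := by linarith
  have e : ∀ m : ℕ, ((N : ℝ) - m) * q / (((m : ℝ) + 1) * (1 - q)) =
      q / (1 - q) * (((N : ℝ) + 1) / ((m : ℝ) + 1) - 1) := by
    intro m
    have : (m : ℝ) + 1 ≠ 0 := by positivity
    field_simp
    ring
  rw [e, e]
  refine mul_le_mul_of_nonneg_left (sub_le_sub_right ?_ _) (div_nonneg hq0 h1q.le)
  exact div_le_div_of_nonneg_left (by positivity) (by positivity) (by exact_mod_cast Nat.succ_le_succ h)

theorem ratio_nonneg (hq0 : 0 ≤ q) (hq1 : q < 1) {ℓ : ℕ} (hℓ : ℓ ≤ N) : 0 ≤ ratio N q ℓ := by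
  unfold ratio
  have : (0 : ℝ) ≤ (N : ℝ) - ℓ := by rw [sub_nonneg]; exact_mod_cast hℓ
  have h1q : 0 < 1 - q := by linarith
  positivity

/-- **Log-concavity in ratio form**: for `ℓ ≤ ℓ'` and every `t`, `B(ℓ'+t)·B(ℓ) ≤ B(ℓ+t)·B(ℓ')`. [folklore] -/
theorem pmf_logConcave (hq0 : 0 ≤ q) (hq1 : q < 1) {ℓ ℓ' : ℕ} (h : ℓ ≤ ℓ') :
    ∀ t : ℕ, binomPMF N q (ℓ' + t) * binomPMF N q ℓ ≤ binomPMF N q (ℓ + t) * binomPMF N q ℓ' := by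
  intro t
  induction t with
  | zero => rw [add_zero, add_zero, mul_comm]
  | succ t ih =>
    rcases lt_or_ge N (ℓ' + t + 1) with hbig | hsmall
    · rw [← add_assoc, binomPMF_eq_zero_of_lt hbig, zero_mul]
      exact mul_nonneg (binomPMF_nonneg hq0 hq1.le _) (binomPMF_nonneg hq0 hq1.le _)
    · have hr0 : 0 ≤ ratio N q (ℓ' + t) := ratio_nonneg hq0 hq1 (by omega)
      have hrr : ratio N q (ℓ' + t) ≤ ratio N q (ℓ + t) := ratio_antitone hq0 hq1 (by omega)
      have hB : 0 ≤ binomPMF N q (ℓ + t) * binomPMF N q ℓ' :=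
        mul_nonneg (binomPMF_nonneg hq0 hq1.le _) (binomPMF_nonneg hq0 hq1.le _)
      calc binomPMF N q (ℓ' + (t + 1)) * binomPMF N q ℓ
          = ratio N q (ℓ' + t) * (binomPMF N q (ℓ' + t) * binomPMF N q ℓ) := by
            rw [← add_assoc, binomPMF_succ hq1.ne, mul_assoc]
        _ ≤ ratio N q (ℓ' + t) * (binomPMF N q (ℓ + t) * binomPMF N q ℓ') :=
            mul_le_mul_of_nonneg_left ih hr0
        _ ≤ ratio N q (ℓ + t) * (binomPMF N q (ℓ + t) * binomPMF N q ℓ') :=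
            mul_le_mul_of_nonneg_right hrr hB
        _ = binomPMF N q (ℓ + (t + 1)) * binomPMF N q ℓ' := by
            rw [← add_assoc, binomPMF_succ hq1.ne (ℓ + t), mul_assoc]

/-- Total mass `Σ_{ℓ ≤ N} B(ℓ) = 1`. [folklore] -/
theorem sum_binomPMF (N : ℕ) (q : ℝ) : ∑ ℓ ∈ Finset.range (N + 1), binomPMF N q ℓ = 1 := by
  have h := (add_pow q (1 - q) N).symm
  rw [add_sub_cancel, one_pow] at h
  rw [← h]
  refine Finset.sum_congr rfl fun ℓ _ => ?_
  unfold binomPMF; ring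

/-- Unnormalised variance `Σ_{ℓ ≤ N} (Nq − ℓ)² B(ℓ) = Nq(1−q)` (Bernstein). [folklore] -/
theorem sum_sq_mul_binomPMF (N : ℕ) (q : ℝ) :
    ∑ ℓ ∈ Finset.range (N + 1), ((N : ℝ) * q - ℓ) ^ 2 * binomPMF N q ℓ = N * q * (1 - q) := by
  have h := congrArg (Polynomial.eval q) (bernsteinPolynomial.variance ℝ N)
  simp only [Polynomial.eval_finsetSum, Polynomial.eval_mul, Polynomial.eval_pow, Polynomial.eval_sub,
    nsmul_eq_mul, Polynomial.eval_natCast, Polynomial.eval_X, Polynomial.eval_one, bernsteinPolynomial] at h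
  rw [← h]
  refine Finset.sum_congr rfl fun ℓ _ => ?_
  unfold binomPMF; ring

end Basic

section Sums

variable {N : ℕ} {q : ℝ}

/-- Reindex an upper tail. [folklore] -/
theorem sum_Ioc_eq (f : ℕ → ℝ) (a N : ℕ) :
    ∑ ℓ ∈ Finset.Ioc a N, f ℓ = ∑ t ∈ Finset.range (N - a), f (a + 1 + t) := by
  have : Finset.Ioc a N = Finset.Ico (a + 1) (N + 1) := by
    ext k; simp only [Finset.mem_Ioc, Finset.mem_Ico]; omega
  rw [this, Finset.sum_Ico_eq_sum_range]
  congr 1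
  congr 1
  omega

/-- **Upper hazard monotonicity**: for `j ≤ i`, `P[X ≥ i+1]·B(j+1) ≤ B(i+1)·P[X ≥ j+1]`. [folklore] -/
theorem upperTail_mul_le (hq0 : 0 ≤ q) (hq1 : q < 1) {j i : ℕ} (hji : j ≤ i) :
    (∑ ℓ ∈ Finset.Ioc i N, binomPMF N q ℓ) * binomPMF N q (j + 1) ≤
      binomPMF N q (i + 1) * ∑ ℓ ∈ Finset.Ioc j N, binomPMF N q ℓ := by
  rw [sum_Ioc_eq, sum_Ioc_eq, Finset.sum_mul, Finset.mul_sum]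
  calc ∑ t ∈ Finset.range (N - i), binomPMF N q (i + 1 + t) * binomPMF N q (j + 1)
      ≤ ∑ t ∈ Finset.range (N - i), binomPMF N q (i + 1) * binomPMF N q (j + 1 + t) :=
        Finset.sum_le_sum fun t _ => by
          have := pmf_logConcave (N := N) hq0 hq1 (show j + 1 ≤ i + 1 by omega) t
          linarith [mul_comm (binomPMF N q (j + 1 + t)) (binomPMF N q (i + 1))]
    _ ≤ ∑ t ∈ Finset.range (N - j), binomPMF N q (i + 1) * binomPMF N q (j + 1 + t) :=
        Finset.sum_le_sum_of_subset_of_nonneg (Finset.range_subset_range.2 (by omega))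
          fun t _ _ => mul_nonneg (binomPMF_nonneg hq0 hq1.le _) (binomPMF_nonneg hq0 hq1.le _)

/-- **Lower hazard monotonicity**: for `i < j`, `P[X ≤ i]·B(j−1) ≤ B(i)·P[X ≤ j−1]`. [folklore] -/
theorem lowerTail_mul_le (hq0 : 0 ≤ q) (hq1 : q < 1) {j i : ℕ} (hij : i < j) :
    (∑ ℓ ∈ Finset.range (i + 1), binomPMF N q ℓ) * binomPMF N q (j - 1) ≤
      binomPMF N q i * ∑ ℓ ∈ Finset.range j, binomPMF N q ℓ := by
  rw [Finset.sum_mul]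
  have step : ∀ s ∈ Finset.range (i + 1),
      binomPMF N q s * binomPMF N q (j - 1) ≤ binomPMF N q i * binomPMF N q (s + (j - 1 - i)) := by
    intro s hs
    rw [Finset.mem_range] at hs
    have h := pmf_logConcave (N := N) hq0 hq1 (show s ≤ s + (j - 1 - i) by omega) (i - s)
    rw [show s + (j - 1 - i) + (i - s) = j - 1 by omega, show s + (i - s) = i by omega] at h
    linarith [mul_comm (binomPMF N q s) (binomPMF N q (j - 1))]
  refine (Finset.sum_le_sum step).trans ?_
  rw [← Finset.mul_sum]
  refine mul_le_mul_of_nonneg_left ?_ (binomPMF_nonneg hq0 hq1.le _)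
  have hre : ∑ s ∈ Finset.range (i + 1), binomPMF N q (s + (j - 1 - i)) =
      ∑ ℓ ∈ Finset.Ico (j - 1 - i) j, binomPMF N q ℓ := by
    rw [Finset.sum_Ico_eq_sum_range, show j - (j - 1 - i) = i + 1 by omega]
    exact Finset.sum_congr rfl fun s _ => by rw [add_comm]
  rw [hre, Finset.range_eq_Ico]
  exact Finset.sum_le_sum_of_subset_of_nonneg (Finset.Ico_subset_Ico (Nat.zero_le _) le_rfl)
    fun t _ _ => binomPMF_nonneg hq0 hq1.le _

/-- A partial sum of the pmf is at most `1`. [folklore] -/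
theorem sum_binomPMF_le_one (hq0 : 0 ≤ q) (hq1 : q ≤ 1) {s : Finset ℕ} (hs : s ⊆ Finset.range (N + 1)) :
    ∑ ℓ ∈ s, binomPMF N q ℓ ≤ 1 := by
  rw [← sum_binomPMF N q]
  exact Finset.sum_le_sum_of_subset_of_nonneg hs fun t _ _ => binomPMF_nonneg hq0 hq1 _

end Sums

section Matched

variable {N j : ℕ}

/-- The ratio at the matched density `q = j/N`. [folklore] -/
theorem ratio_matched (hjN : j < N) (ℓ : ℕ) :
    ratio N ((j : ℝ) / N) ℓ = ((N : ℝ) - ℓ) * j / (((ℓ : ℝ) + 1) * ((N : ℝ) - j)) := by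
  unfold ratio
  have hN : (0 : ℝ) < N := by exact_mod_cast (show 0 < N by omega)
  have hNj : (0 : ℝ) < (N : ℝ) - j := by rw [sub_pos]; exact_mod_cast hjN
  field_simp

/-- Below the mode the ratio is `≥ 1`. [folklore] -/
theorem one_le_ratio_matched (hjN : j < N) {ℓ : ℕ} (hℓ : ℓ + 1 ≤ j) : 1 ≤ ratio N ((j : ℝ) / N) ℓ := by
  rw [ratio_matched hjN]
  have hNj : (0 : ℝ) < (N : ℝ) - j := by rw [sub_pos]; exact_mod_cast hjN
  have hℓj : (ℓ : ℝ) + 1 ≤ j := by exact_mod_cast hℓ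
  have hjN' : (j : ℝ) ≤ N := by exact_mod_cast hjN.le
  have hN0 : (0 : ℝ) ≤ N := Nat.cast_nonneg _
  rw [le_div_iff₀ (by positivity), one_mul]
  nlinarith

/-- From the mode on the ratio is `≤ 1`. [folklore] -/
theorem ratio_matched_le_one (hjN : j < N) {ℓ : ℕ} (hℓ : j ≤ ℓ) (hℓN : ℓ ≤ N) :
    ratio N ((j : ℝ) / N) ℓ ≤ 1 := by
  rw [ratio_matched hjN]
  have hNj : (0 : ℝ) < (N : ℝ) - j := by rw [sub_pos]; exact_mod_cast hjN
  have hℓj : (j : ℝ) ≤ ℓ := by exact_mod_cast hℓ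
  have hℓN' : (ℓ : ℝ) ≤ N := by exact_mod_cast hℓN
  have hj0 : (0 : ℝ) ≤ j := Nat.cast_nonneg _
  rw [div_le_iff₀ (by positivity), one_mul]
  nlinarith

/-- **`j` is a mode of `Bin(N, j/N)`**: `B(ℓ) ≤ B(j)` for every `ℓ`. [folklore] -/
theorem binomPMF_le_mode (hj : 0 < j) (hjN : j < N) (ℓ : ℕ) :
    binomPMF N ((j : ℝ) / N) ℓ ≤ binomPMF N ((j : ℝ) / N) j := by
  have hN : (0 : ℝ) < N := by exact_mod_cast (show 0 < N by omega)
  have hq0 : 0 ≤ (j : ℝ) / N := by positivity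
  have hq1 : (j : ℝ) / N < 1 := by rw [div_lt_one hN]; exact_mod_cast hjN
  have hB0 : ∀ m, 0 ≤ binomPMF N ((j : ℝ) / N) m := binomPMF_nonneg hq0 hq1.le
  -- increasing up to `j`
  have up : ∀ d m : ℕ, m + d ≤ j → binomPMF N ((j : ℝ) / N) m ≤ binomPMF N ((j : ℝ) / N) (m + d) := by
    intro d
    induction d with
    | zero => intro m _; simp
    | succ d ih =>
      intro m hm
      refine (ih m (by omega)).trans ?_
      rw [← add_assoc, binomPMF_succ hq1.ne]
      exact le_mul_of_one_le_left (hB0 _) (one_le_ratio_matched hjN (by omega))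
  -- decreasing from `j`
  have down : ∀ d : ℕ, binomPMF N ((j : ℝ) / N) (j + d) ≤ binomPMF N ((j : ℝ) / N) j := by
    intro d
    induction d with
    | zero => simp
    | succ d ih =>
      refine le_trans ?_ ih
      rcases lt_or_ge N (j + d + 1) with hbig | hsmall
      · rw [← add_assoc, binomPMF_eq_zero_of_lt hbig]; exact hB0 _
      · rw [← add_assoc, binomPMF_succ hq1.ne]
        exact mul_le_of_le_one_left (hB0 _) (ratio_matched_le_one hjN (by omega) (by omega))
  rcases le_or_gt ℓ j with h | h
  · have := up (j - ℓ) ℓ (by omega)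
    rwa [show ℓ + (j - ℓ) = j by omega] at this
  · have := down (ℓ - j)
    rwa [show j + (ℓ - j) = ℓ by omega] at this

/-- `B(j) ≤ 2·B(j+1)` at the matched density. [folklore] -/
theorem mode_le_two_mul_succ (hj : 0 < j) (hjN : j < N) :
    binomPMF N ((j : ℝ) / N) j ≤ 2 * binomPMF N ((j : ℝ) / N) (j + 1) := by
  have hN : (0 : ℝ) < N := by exact_mod_cast (show 0 < N by omega)
  have hq1 : (j : ℝ) / N < 1 := by rw [div_lt_one hN]; exact_mod_cast hjN
  have hNj : (0 : ℝ) < (N : ℝ) - j := by rw [sub_pos]; exact_mod_cast hjN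
  have hj1 : (1 : ℝ) ≤ j := by exact_mod_cast hj
  have hr : ratio N ((j : ℝ) / N) j = (j : ℝ) / ((j : ℝ) + 1) := by
    rw [ratio_matched hjN]; field_simp
  have hr2 : (1 : ℝ) ≤ 2 * ratio N ((j : ℝ) / N) j := by
    rw [hr, mul_div_assoc', le_div_iff₀ (by positivity)]; linarith
  rw [binomPMF_succ hq1.ne, ← mul_assoc]
  exact le_mul_of_one_le_left (binomPMF_nonneg (by positivity) hq1.le _) hr2

/-- `B(j) ≤ 2·B(j−1)` at the matched density. [folklore] -/
theorem mode_le_two_mul_pred (hj : 0 < j) (hjN : j < N) :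
    binomPMF N ((j : ℝ) / N) j ≤ 2 * binomPMF N ((j : ℝ) / N) (j - 1) := by
  have hN : (0 : ℝ) < N := by exact_mod_cast (show 0 < N by omega)
  have hq1 : (j : ℝ) / N < 1 := by rw [div_lt_one hN]; exact_mod_cast hjN
  have hNj : (1 : ℝ) ≤ (N : ℝ) - j := by
    have : ((j + 1 : ℕ) : ℝ) ≤ N := by exact_mod_cast hjN
    push_cast at this; linarith
  obtain ⟨j', rfl⟩ : ∃ j', j = j' + 1 := ⟨j - 1, by omega⟩
  rw [Nat.add_sub_cancel, binomPMF_succ hq1.ne j']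
  refine mul_le_mul_of_nonneg_right ?_ (binomPMF_nonneg (by positivity) hq1.le _)
  rw [ratio_matched hjN]
  push_cast at hNj ⊢
  have hj0 : (0 : ℝ) ≤ (j' : ℝ) + 1 := by positivity
  have hden : (0 : ℝ) < ((j' : ℝ) + 1) * ((N : ℝ) - ((j' : ℝ) + 1)) := mul_pos (by positivity) (by linarith)
  rw [div_le_iff₀ hden]
  nlinarith [mul_le_mul_of_nonneg_right hNj hj0]

/-- `j·B(i) ≤ (i+1)·B(i+1)` for `i < j` at the matched density. [folklore] -/
theorem mul_le_succ_mul (hjN : j < N) {i : ℕ} (hij : i < j) :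
    (j : ℝ) * binomPMF N ((j : ℝ) / N) i ≤ ((i : ℝ) + 1) * binomPMF N ((j : ℝ) / N) (i + 1) := by
  have hN : (0 : ℝ) < N := by exact_mod_cast (show 0 < N by omega)
  have hq1 : (j : ℝ) / N < 1 := by rw [div_lt_one hN]; exact_mod_cast hjN
  have hNj : (0 : ℝ) < (N : ℝ) - j := by rw [sub_pos]; exact_mod_cast hjN
  have hr : (j : ℝ) ≤ ((i : ℝ) + 1) * ratio N ((j : ℝ) / N) i := by
    rw [ratio_matched hjN, mul_div_assoc', le_div_iff₀ (by positivity)]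
    have hij' : (i : ℝ) ≤ j := by exact_mod_cast hij.le
    have hj0 : (0 : ℝ) ≤ j := Nat.cast_nonneg _
    have hi1 : (0 : ℝ) ≤ (i : ℝ) + 1 := by positivity
    nlinarith [mul_nonneg (mul_nonneg hj0 hi1) (sub_nonneg.2 hij')]
  rw [binomPMF_succ hq1.ne, ← mul_assoc]
  exact mul_le_mul_of_nonneg_right hr (binomPMF_nonneg (by positivity) hq1.le _)

/-- **Modal lower bound** (Chebyshev + unimodality): `3/(20√j) ≤ B(j)` at the matched density. [folklore] -/
theorem modal_lb (hj : 0 < j) (hjN : j < N) :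
    3 / (20 * Real.sqrt j) ≤ binomPMF N ((j : ℝ) / N) j := by
  have hN : (0 : ℝ) < N := by exact_mod_cast (show 0 < N by omega)
  set q : ℝ := (j : ℝ) / N with hq
  have hq0 : 0 ≤ q := by positivity
  have hq1 : q < 1 := by rw [hq, div_lt_one hN]; exact_mod_cast hjN
  have hNq : (N : ℝ) * q = j := by rw [hq]; field_simp
  have hj1 : (1 : ℝ) ≤ j := by exact_mod_cast hj
  have hjpos : (0 : ℝ) < j := by linarith
  have hsq1 : 1 ≤ Real.sqrt j := by rw [Real.le_sqrt' one_pos]; simpa using hj1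
  have hsq0 : 0 < Real.sqrt j := by linarith
  have hB0 : ∀ m, 0 ≤ binomPMF N q m := binomPMF_nonneg hq0 hq1.le
  set B : ℕ → ℝ := binomPMF N q with hB
  set t : ℕ := Nat.sqrt (4 * j) with ht
  -- the window `S` and its size
  set S := (Finset.range (N + 1)).filter (fun ℓ : ℕ => ((ℓ : ℝ) - j) ^ 2 < 4 * j) with hS
  have hSsub : S ⊆ Finset.Icc (j - t) (j + t) := by
    intro ℓ hℓ
    rw [hS, Finset.mem_filter] at hℓ
    rw [Finset.mem_Icc]
    have h4 : (4 * j : ℝ) < ((t : ℝ) + 1) ^ 2 := by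
      have := Nat.lt_succ_sqrt' (4 * j)
      rw [← ht] at this
      exact_mod_cast this
    by_contra hc
    rcases not_and_or.1 hc with h1 | h1
    · have h2 : (t : ℝ) + 1 ≤ (j : ℝ) - ℓ := by
        have : ((ℓ + t + 1 : ℕ) : ℝ) ≤ j := by exact_mod_cast (by omega : ℓ + t + 1 ≤ j)
        push_cast at this; linarith
      have h3 : ((t : ℝ) + 1) ^ 2 ≤ ((ℓ : ℝ) - j) ^ 2 := by
        rw [show ((ℓ : ℝ) - j) ^ 2 = ((j : ℝ) - ℓ) ^ 2 by ring]
        exact pow_le_pow_left₀ (by positivity) h2 2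
      linarith [hℓ.2]
    · have h2 : (t : ℝ) + 1 ≤ (ℓ : ℝ) - j := by
        have : ((j + t + 1 : ℕ) : ℝ) ≤ ℓ := by exact_mod_cast (by omega : j + t + 1 ≤ ℓ)
        push_cast at this; linarith
      have h3 : ((t : ℝ) + 1) ^ 2 ≤ ((ℓ : ℝ) - j) ^ 2 := pow_le_pow_left₀ (by positivity) h2 2
      linarith [hℓ.2]
  have hScard : (S.card : ℝ) ≤ 2 * t + 1 := by
    have h1 : S.card ≤ 2 * t + 1 := by
      refine (Finset.card_le_card hSsub).trans ?_
      rw [Nat.card_Icc]; omega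
    exact_mod_cast h1
  have ht2 : (t : ℝ) ≤ 2 * Real.sqrt j := by
    have h1 : ((t ^ 2 : ℕ) : ℝ) ≤ 4 * j := by exact_mod_cast (ht ▸ Nat.sqrt_le' (4 * j))
    push_cast at h1
    nlinarith [Real.sq_sqrt hjpos.le, Real.sqrt_nonneg j]
  -- mass inside the window
  have hin : ∑ ℓ ∈ S, B ℓ ≤ (2 * t + 1) * B j := by
    calc ∑ ℓ ∈ S, B ℓ ≤ ∑ ℓ ∈ S, B j := Finset.sum_le_sum fun ℓ _ => binomPMF_le_mode hj hjN ℓ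
      _ = S.card * B j := by rw [Finset.sum_const, nsmul_eq_mul]
      _ ≤ (2 * t + 1) * B j := mul_le_mul_of_nonneg_right hScard (hB0 j)
  -- mass outside the window (Chebyshev)
  have hout : ∑ ℓ ∈ (Finset.range (N + 1)).filter (fun ℓ : ℕ => ¬ ((ℓ : ℝ) - j) ^ 2 < 4 * j), B ℓ ≤ 1 / 4 := by
    calc ∑ ℓ ∈ (Finset.range (N + 1)).filter (fun ℓ : ℕ => ¬ ((ℓ : ℝ) - j) ^ 2 < 4 * j), B ℓ
        ≤ ∑ ℓ ∈ (Finset.range (N + 1)).filter (fun ℓ : ℕ => ¬ ((ℓ : ℝ) - j) ^ 2 < 4 * j),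
            ((ℓ : ℝ) - j) ^ 2 / (4 * j) * B ℓ := by
          refine Finset.sum_le_sum fun ℓ hℓ => ?_
          rw [Finset.mem_filter, not_lt] at hℓ
          refine le_mul_of_one_le_left (hB0 ℓ) ?_
          rw [le_div_iff₀ (by positivity), one_mul]; exact hℓ.2
      _ ≤ ∑ ℓ ∈ Finset.range (N + 1), ((ℓ : ℝ) - j) ^ 2 / (4 * j) * B ℓ :=
          Finset.sum_le_sum_of_subset_of_nonneg (Finset.filter_subset _ _)
            fun ℓ _ _ => mul_nonneg (div_nonneg (sq_nonneg _) (by positivity)) (hB0 ℓ)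
      _ = (1 / (4 * j)) * ∑ ℓ ∈ Finset.range (N + 1), ((N : ℝ) * q - ℓ) ^ 2 * B ℓ := by
          rw [Finset.mul_sum]
          refine Finset.sum_congr rfl fun ℓ _ => ?_
          rw [hNq]; ring
      _ = (1 / (4 * j)) * (N * q * (1 - q)) := by rw [hB, sum_sq_mul_binomPMF]
      _ = (1 - q) / 4 := by rw [hNq]; field_simp
      _ ≤ 1 / 4 := by linarith
  have htot : ∑ ℓ ∈ Finset.range (N + 1), B ℓ = 1 := sum_binomPMF N q
  rw [← Finset.sum_filter_add_sum_filter_not _ (fun ℓ : ℕ => ((ℓ : ℝ) - j) ^ 2 < 4 * j)] at htot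
  have h34 : 3 / 4 ≤ (2 * t + 1) * B j := by linarith
  have h5 : (2 * (t : ℝ) + 1) ≤ 5 * Real.sqrt j := by linarith
  have h6 : 3 / 4 ≤ 5 * Real.sqrt j * B j := h34.trans (mul_le_mul_of_nonneg_right h5 (hB0 j))
  rw [div_le_iff₀ (by positivity)]
  linarith

end Matched

/-- `(j/N)^{i+1}(1−j/N)^{N−1−i}·((N−i)C(N,i)) = (i+1)·B(i+1)`. [folklore] -/
theorem base_mul_denom {N i : ℕ} (hiN : i < N) (q : ℝ) :
    q ^ (i + 1) * (1 - q) ^ (N - 1 - i) * (((N - i : ℕ) : ℝ) * (N.choose i : ℝ)) =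
      ((i : ℝ) + 1) * binomPMF N q (i + 1) := by
  unfold binomPMF
  have hc : ((N.choose (i + 1) : ℕ) : ℝ) * ((i : ℝ) + 1) = (N.choose i : ℝ) * ((N - i : ℕ) : ℝ) := by
    have := Nat.choose_succ_right_eq N i
    exact_mod_cast this
  rw [show N - 1 - i = N - (i + 1) by omega]
  linear_combination (-(q ^ (i + 1) * (1 - q) ^ (N - (i + 1)))) * hc

/-- **Stub 2 (`BinomialHazardStmt`) proved** with `K₀ = 40/3`. [folklore] -/
theorem binomialHazard :
    ∃ K₀ : ℝ, 0 < K₀ ∧ ∀ (N j i : ℕ), 0 < j → j < N → i < N →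
      hybridWeight N ((j : ℝ) / N) j i / (((N - i : ℕ) : ℝ) * (N.choose i : ℝ)) ≤
        K₀ / Real.sqrt j * (((j : ℝ) / N) ^ (i + 1) * (1 - (j : ℝ) / N) ^ (N - 1 - i)) := by
  refine ⟨40 / 3, by norm_num, fun N j i hj hjN hiN => ?_⟩
  have hN : (0 : ℝ) < N := by exact_mod_cast (show 0 < N by omega)
  set q : ℝ := (j : ℝ) / N with hq
  have hq0 : 0 ≤ q := by positivity
  have hq1 : q < 1 := by rw [hq, div_lt_one hN]; exact_mod_cast hjN
  have hj1 : (1 : ℝ) ≤ j := by exact_mod_cast hj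
  have hjpos : (0 : ℝ) < j := by linarith
  have hsq0 : 0 < Real.sqrt j := Real.sqrt_pos.2 hjpos
  have hsqsq : Real.sqrt j * Real.sqrt j = j := Real.mul_self_sqrt hjpos.le
  have hB0 : ∀ m, 0 ≤ binomPMF N q m := binomPMF_nonneg hq0 hq1.le
  set B : ℕ → ℝ := binomPMF N q with hB
  have hD : (0 : ℝ) < ((N - i : ℕ) : ℝ) * (N.choose i : ℝ) := by
    have h1 : (0 : ℝ) < ((N - i : ℕ) : ℝ) := by exact_mod_cast (show 0 < N - i by omega)
    have h2 : (0 : ℝ) < (N.choose i : ℝ) := by exact_mod_cast Nat.choose_pos hiN.le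
    exact mul_pos h1 h2
  rw [div_le_iff₀ hD, mul_assoc, base_mul_denom hiN q]
  -- the modal bound in the form `1 ≤ (20√j/3)·B(j)`
  have hmode : 3 / (20 * Real.sqrt j) ≤ B j := modal_lb hj hjN
  have hmode' : 3 ≤ 20 * Real.sqrt j * B j := by
    rwa [div_le_iff₀ (by positivity), mul_comm] at hmode
  rw [hybridWeight]
  split_ifs with hji
  · -- upper tail, `j ≤ i`
    have hj1N : j + 1 ≤ N := by omega
    have hBj1 : 0 < B (j + 1) := binomPMF_pos (by positivity) hq1 hj1N
    have htail : (∑ ℓ ∈ Finset.Ioc i N, B ℓ) * B (j + 1) ≤ B (i + 1) := by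
      refine (upperTail_mul_le hq0 hq1 hji).trans ?_
      refine mul_le_of_le_one_right (hB0 _) (sum_binomPMF_le_one hq0 hq1.le ?_)
      intro ℓ hℓ; rw [Finset.mem_Ioc] at hℓ; rw [Finset.mem_range]; omega
    have h2 : B j ≤ 2 * B (j + 1) := mode_le_two_mul_succ hj hjN
    -- `W ≤ B(i+1)/B(j+1) ≤ (40√j/3)·B(i+1) ≤ (40/3)/√j·(i+1)·B(i+1)`
    have hW : ∑ ℓ ∈ Finset.Ioc i N, B ℓ ≤ 40 * Real.sqrt j / 3 * B (i + 1) := by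
      have h3 : 3 ≤ 40 * Real.sqrt j * B (j + 1) := by nlinarith
      have h4 : (∑ ℓ ∈ Finset.Ioc i N, B ℓ) * (3 : ℝ) ≤
          (∑ ℓ ∈ Finset.Ioc i N, B ℓ) * (40 * Real.sqrt j * B (j + 1)) :=
        mul_le_mul_of_nonneg_left h3 (Finset.sum_nonneg fun ℓ _ => hB0 ℓ)
      nlinarith [mul_le_mul_of_nonneg_left htail (by positivity : (0 : ℝ) ≤ 40 * Real.sqrt j)]
    have hji' : (j : ℝ) ≤ (i : ℝ) + 1 := by exact_mod_cast (by omega : j ≤ i + 1)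
    calc ∑ ℓ ∈ Finset.Ioc i N, B ℓ ≤ 40 * Real.sqrt j / 3 * B (i + 1) := hW
      _ ≤ 40 / 3 / Real.sqrt j * (((i : ℝ) + 1) * B (i + 1)) := by
          rw [div_mul_eq_mul_div, div_mul_eq_mul_div, div_le_div_iff₀ (by norm_num) hsq0]
          have : 0 ≤ B (i + 1) := hB0 _
          nlinarith
  · -- lower tail, `i < j`
    push Not at hji
    have hjm1 : j - 1 ≤ N := by omega
    have hBj1 : 0 < B (j - 1) := binomPMF_pos (by positivity) hq1 hjm1
    have htail : (∑ ℓ ∈ Finset.range (i + 1), B ℓ) * B (j - 1) ≤ B i := by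
      refine (lowerTail_mul_le hq0 hq1 hji).trans ?_
      refine mul_le_of_le_one_right (hB0 _) (sum_binomPMF_le_one hq0 hq1.le ?_)
      exact Finset.range_subset_range.2 (by omega)
    have h2 : B j ≤ 2 * B (j - 1) := mode_le_two_mul_pred hj hjN
    have hW : ∑ ℓ ∈ Finset.range (i + 1), B ℓ ≤ 40 * Real.sqrt j / 3 * B i := by
      have h3 : 3 ≤ 40 * Real.sqrt j * B (j - 1) := by nlinarith
      have h4 : (∑ ℓ ∈ Finset.range (i + 1), B ℓ) * (3 : ℝ) ≤
          (∑ ℓ ∈ Finset.range (i + 1), B ℓ) * (40 * Real.sqrt j * B (j - 1)) :=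
        mul_le_mul_of_nonneg_left h3 (Finset.sum_nonneg fun ℓ _ => hB0 ℓ)
      nlinarith [mul_le_mul_of_nonneg_left htail (by positivity : (0 : ℝ) ≤ 40 * Real.sqrt j)]
    have hstep : (j : ℝ) * B i ≤ ((i : ℝ) + 1) * B (i + 1) := mul_le_succ_mul hjN hji
    calc ∑ ℓ ∈ Finset.range (i + 1), B ℓ ≤ 40 * Real.sqrt j / 3 * B i := hW
      _ ≤ 40 / 3 / Real.sqrt j * (((i : ℝ) + 1) * B (i + 1)) := by
          rw [div_mul_eq_mul_div, div_mul_eq_mul_div, div_le_div_iff₀ (by norm_num) hsq0]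
          have : 0 ≤ B i := hB0 _
          nlinarith


end S2

namespace S3


open Finset



section Lemmas

variable {ι : Type}

/-- Restricting by `y` with `y_i = 0` hides coordinate `i`. [folklore] -/
theorem and_update_of_false [DecidableEq ι] {y : ι → Bool} {i : ι} (hyi : y i = false) (z : ι → Bool) :
    (fun j => y j && Function.update z i true j) = fun j => y j && z j := by
  funext j
  by_cases h : j = i
  · subst h; simp [hyi]
  · rw [Function.update_of_ne h]

/-- Restricting by `y` with `y_i = 1` commutes with setting `x_i := 1`. [folklore] -/
theorem and_update_of_true [DecidableEq ι] {y : ι → Bool} {i : ι} (hyi : y i = true) (z : ι → Bool) :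
    (fun j => y j && Function.update z i true j) = Function.update (fun j => y j && z j) i true := by
  funext j
  by_cases h : j = i
  · subst h; simp [hyi]
  · rw [Function.update_of_ne h, Function.update_of_ne h]

/-- Product form of the `μ_q` weight. [folklore] -/
theorem prodWeight_eq_prod [Fintype ι] (q : ℝ) (x : ι → Bool) :
    prodWeight q x = ∏ i, (if x i = true then q else 1 - q) := by
  have hc : #(univ.filter fun i => ¬ x i = true) = Fintype.card ι - wt x := by
    have h := Finset.card_filter_add_card_filter_not (s := (univ : Finset ι)) (fun i => x i = true)
    rw [Finset.card_univ] at h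
    rw [wt]
    omega
  rw [Finset.prod_ite, Finset.prod_const, Finset.prod_const, hc]
  rfl

variable [Fintype ι] [DecidableEq ι]

/-- **Coordinatewise pushforward under `∧`.** For a product weight `Π_j φ_j(y_j, z_j)` on pairs and any `G`:
`Σ_{y,z} (Π_j φ_j(y_j,z_j))·G(y ∧ z) = Σ_x (Π_j ψ_j(x_j))·G(x)`, `ψ_j(c) = Σ_{a ∧ b = c} φ_j(a,b)`. [folklore] -/
theorem sum_sum_prod_mul_and (φ : ι → Bool → Bool → ℝ) (G : (ι → Bool) → ℝ) :
    ∑ y : ι → Bool, ∑ z : ι → Bool, (∏ j, φ j (y j) (z j)) * G (fun j => y j && z j) =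
      ∑ x : ι → Bool, (∏ j, ∑ a : Bool, ∑ b : Bool, if (a && b) = x j then φ j a b else 0) * G x := by
  -- merge `(y,z)` into one function `c : ι → Bool × Bool`
  have hmerge : ∑ y : ι → Bool, ∑ z : ι → Bool, (∏ j, φ j (y j) (z j)) * G (fun j => y j && z j) =
      ∑ c : ι → Bool × Bool, (∏ j, φ j (c j).1 (c j).2) * G (fun j => (c j).1 && (c j).2) := by
    rw [← Fintype.sum_prod_type']
    exact (Fintype.sum_equiv (Equiv.arrowProdEquivProdArrow ι (fun _ => Bool) (fun _ => Bool))
      (fun c : ι → Bool × Bool => (∏ j, φ j (c j).1 (c j).2) * G (fun j => (c j).1 && (c j).2))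
      (fun p : (ι → Bool) × (ι → Bool) => (∏ j, φ j (p.1 j) (p.2 j)) * G (fun j => p.1 j && p.2 j))
      (fun c => rfl)).symm
  rw [hmerge, ← Finset.sum_fiberwise (s := (univ : Finset (ι → Bool × Bool)))
    (g := fun c j => (c j).1 && (c j).2)]
  refine Finset.sum_congr rfl fun x _ => ?_
  have hfac : ∑ c ∈ univ.filter (fun c : ι → Bool × Bool => (fun j => (c j).1 && (c j).2) = x),
        (∏ j, φ j (c j).1 (c j).2) * G (fun j => (c j).1 && (c j).2) =
      (∑ c ∈ univ.filter (fun c : ι → Bool × Bool => (fun j => (c j).1 && (c j).2) = x),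
        ∏ j, φ j (c j).1 (c j).2) * G x := by
    rw [Finset.sum_mul]
    refine Finset.sum_congr rfl fun c hc => ?_
    simp only [Finset.mem_filter, Finset.mem_univ, true_and] at hc
    rw [hc]
  rw [hfac]
  congr 1
  have hfib : univ.filter (fun c : ι → Bool × Bool => (fun j => (c j).1 && (c j).2) = x) =
      Fintype.piFinset (fun j => univ.filter fun ab : Bool × Bool => (ab.1 && ab.2) = x j) := by
    ext c
    simp only [Finset.mem_filter, Finset.mem_univ, true_and, Fintype.mem_piFinset, funext_iff]
  rw [hfib, ← Finset.prod_univ_sum (fun j => univ.filter fun ab : Bool × Bool => (ab.1 && ab.2) = x j)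
    (fun j ab => φ j ab.1 ab.2)]
  refine Finset.prod_congr rfl fun j _ => ?_
  rw [Finset.sum_filter, Fintype.sum_prod_type]

/-- The influence as a double sum over directions and points. [folklore] -/
theorem biasedInfluence_eq_sum_sum (r : ℝ) (g : (ι → Bool) → Bool) :
    biasedInfluence r g = ∑ i : ι, ∑ x : ι → Bool,
      if x i = false ∧ g x ≠ g (Function.update x i true) then
        r ^ wt x * (1 - r) ^ (Fintype.card ι - 1 - wt x) else 0 := by
  rw [biasedInfluence, upPivotal, Finset.sum_filter, Fintype.sum_prod_type_right]

/-- Off-`i` product form of the edge weight when `x_i = 0`. [folklore] -/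
theorem edgeWeight_eq_prod_erase (r : ℝ) (x : ι → Bool) (i : ι) (hxi : x i = false) :
    r ^ wt x * (1 - r) ^ (Fintype.card ι - 1 - wt x) =
      ∏ j ∈ univ.erase i, (if x j = true then r else 1 - r) := by
  rw [Finset.prod_ite, Finset.prod_const, Finset.prod_const]
  have hA : (univ.erase i).filter (fun j => x j = true) = univ.filter (fun j => x j = true) := by
    rw [Finset.filter_erase, Finset.erase_eq_of_notMem]
    simp [hxi]
  have h2 : #((univ.erase i).filter (fun j => x j = true)) +
      #((univ.erase i).filter (fun j => ¬ x j = true)) = Fintype.card ι - 1 := by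
    rw [Finset.card_filter_add_card_filter_not, Finset.card_erase_of_mem (mem_univ _), Finset.card_univ]
  have hwt : #(univ.filter (fun j => x j = true)) = wt x := rfl
  rw [hA, hwt] at h2
  rw [hA, hwt]
  congr 2
  omega

end Lemmas

/-- **Stub 3 (`AndCoinStmt`) proved**: `2q · I_q(f) = Σ_y μ_{2q}(y) · I_{1/2}(f_y)`, `f_y(z) = f(y ∧ z)`.
[cite: ODonnell2014, §8.4] -/
theorem andCoin :
    ∀ (ι : Type) [Fintype ι] [DecidableEq ι] (f : (ι → Bool) → Bool) (q : ℝ), 0 ≤ q → 2 * q ≤ 1 →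
      2 * q * biasedInfluence q f =
        ∑ y : ι → Bool, prodWeight (2 * q) y *
          biasedInfluence (1 / 2) (fun z => f (fun i => y i && z i)) := by
  intro ι _ _ f q _ _
  rw [biasedInfluence_eq_sum_sum q f]
  simp_rw [biasedInfluence_eq_sum_sum (1 / 2)]
  rw [Finset.mul_sum]
  simp_rw [Finset.mul_sum (s := (univ : Finset ι))]
  rw [Finset.sum_comm (s := (univ : Finset (ι → Bool))) (t := (univ : Finset ι))]
  refine Finset.sum_congr rfl fun i _ => ?_
  -- per direction `i`
  set φ : ι → Bool → Bool → ℝ := fun j a b =>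
    if j = i then (if a = true then 2 * q else 0) else ((if a = true then 2 * q else 1 - 2 * q) * (1 / 2))
    with hφ
  set G : (ι → Bool) → ℝ := fun x =>
    if x i = false ∧ f x ≠ f (Function.update x i true) then 1 else 0 with hG
  -- the right side in pushforward form
  have hR : ∑ y : ι → Bool, prodWeight (2 * q) y * ∑ z : ι → Bool,
        (if z i = false ∧ f (fun j => y j && z j) ≠ f (fun j => y j && Function.update z i true j) then
          (1 / 2 : ℝ) ^ wt z * (1 - 1 / 2) ^ (Fintype.card ι - 1 - wt z) else 0) =
      ∑ y : ι → Bool, ∑ z : ι → Bool, (∏ j, φ j (y j) (z j)) * G (fun j => y j && z j) := by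
    refine Finset.sum_congr rfl fun y _ => ?_
    rw [Finset.mul_sum]
    refine Finset.sum_congr rfl fun z _ => ?_
    by_cases hyi : y i = true
    · -- `y_i = 1`: pivotality of `f_y` at `(z,i)` is pivotality of `f` at `(y ∧ z, i)`
      rw [and_update_of_true hyi z]
      have hprodφ : ∏ j, φ j (y j) (z j) = 2 * q * ∏ j ∈ univ.erase i,
          ((if y j = true then 2 * q else 1 - 2 * q) * (1 / 2)) := by
        rw [← Finset.mul_prod_erase univ (fun j => φ j (y j) (z j)) (mem_univ i)]
        congr 1
        · simp [hφ, hyi]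
        · refine Finset.prod_congr rfl fun j hj => ?_
          simp [hφ, Finset.ne_of_mem_erase hj]
      have hw : prodWeight (2 * q) y = 2 * q * ∏ j ∈ univ.erase i, (if y j = true then 2 * q else 1 - 2 * q) := by
        rw [prodWeight_eq_prod, ← Finset.mul_prod_erase univ _ (mem_univ i)]
        simp [hyi]
      have hzi : (fun j => y j && z j) i = z i := by simp [hyi]
      by_cases hp : z i = false ∧ f (fun j => y j && z j) ≠ f (Function.update (fun j => y j && z j) i true)
      · rw [if_pos hp]
        have hGv : G (fun j => y j && z j) = 1 := by rw [hG]; simp only [hzi]; rw [if_pos hp]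
        rw [hGv, mul_one, hprodφ, hw, edgeWeight_eq_prod_erase (1 / 2) z i hp.1, mul_assoc,
          ← Finset.prod_mul_distrib]
        congr 1
        refine Finset.prod_congr rfl fun j _ => ?_
        split_ifs <;> norm_num
      · rw [if_neg hp]
        have hGv : G (fun j => y j && z j) = 0 := by rw [hG]; simp only [hzi]; rw [if_neg hp]
        rw [hGv, mul_zero, mul_zero]
    · -- `y_i = 0`: nothing is pivotal in direction `i`, and `φ_i = 0`
      have hyi' : y i = false := by cases h : y i <;> simp_all
      rw [and_update_of_false hyi' z]
      have hp : ¬ (z i = false ∧ f (fun j => y j && z j) ≠ f (fun j => y j && z j)) := fun h => h.2 rfl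
      rw [if_neg hp, mul_zero]
      have : ∏ j, φ j (y j) (z j) = 0 :=
        Finset.prod_eq_zero (mem_univ i) (by simp [hφ, hyi'])
      rw [this, zero_mul]
  rw [hR, sum_sum_prod_mul_and φ G, Finset.mul_sum]
  refine Finset.sum_congr rfl fun x _ => ?_
  -- the pushforward weights: `ψ_i ≡ 2q`, `ψ_j = μ_q` off `i`
  have hψ : ∀ (j : ι) (c : Bool), (∑ a : Bool, ∑ b : Bool, if (a && b) = c then φ j a b else 0) =
      if j = i then 2 * q else (if c = true then q else 1 - q) := by
    intro j c
    by_cases hj : j = i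
    · cases c <;> simp [hφ, hj]
    · cases c <;> simp [hφ, hj] <;> ring
  simp_rw [hψ]
  rw [← Finset.mul_prod_erase univ _ (mem_univ i), if_pos rfl]
  have hrest : ∏ j ∈ univ.erase i, (if j = i then 2 * q else if x j = true then q else 1 - q) =
      ∏ j ∈ univ.erase i, (if x j = true then q else 1 - q) :=
    Finset.prod_congr rfl fun j hj => by rw [if_neg (Finset.ne_of_mem_erase hj)]
  rw [hrest]
  by_cases hp : x i = false ∧ f x ≠ f (Function.update x i true)
  · rw [if_pos hp, hG]
    simp only
    rw [if_pos hp, mul_one, edgeWeight_eq_prod_erase q x i hp.1]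
  · rw [if_neg hp, hG]
    simp only
    rw [if_neg hp, mul_zero, mul_zero]


end S3

namespace S4a


open Finset Literature.Computability.Complexity Literature.Computability.Complexity.LowDegree
open Literature.Probability.RandomGraphs.LowDegree (sgn walsh)

variable {m : ℕ}

/-- Flip coordinate `i`. [folklore] -/
def flipAt (i : Fin m) (x : Fin m → Bool) : Fin m → Bool := Function.update x i (!x i)

/-- Value of the flipped point at `i`. [folklore] -/
theorem flipAt_apply_same (i : Fin m) (x : Fin m → Bool) : flipAt i x i = !x i := by
  simp [flipAt]

/-- Value of the flipped point off `i`. [folklore] -/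
theorem flipAt_apply_ne {i j : Fin m} (h : j ≠ i) (x : Fin m → Bool) : flipAt i x j = x j := by
  simp [flipAt, h]

/-- Flipping twice is the identity. [folklore] -/
theorem flipAt_flipAt (i : Fin m) (x : Fin m → Bool) : flipAt i (flipAt i x) = x := by
  funext j
  by_cases h : j = i
  · subst h; rw [flipAt_apply_same, flipAt_apply_same, Bool.not_not]
  · rw [flipAt_apply_ne h, flipAt_apply_ne h]

/-- `sgn (¬b) = −sgn b`. [folklore] -/
theorem sgn_bnot (b : Bool) : sgn (!b) = -sgn b := by cases b <;> simp [sgn]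

/-- A character at the flipped point: `χ_S(x^{⊕i}) = (-1)^{[i∈S]} χ_S(x)`. [cite: ODonnell2014, §1.2] -/
theorem walsh_flipAt (S : Finset (Fin m)) (i : Fin m) (x : Fin m → Bool) :
    walsh S (flipAt i x) = (if i ∈ S then -1 else 1) * walsh S x := by
  unfold walsh
  by_cases hi : i ∈ S
  · rw [if_pos hi, ← Finset.mul_prod_erase S (fun j => sgn (flipAt i x j)) hi,
      ← Finset.mul_prod_erase S (fun j => sgn (x j)) hi, flipAt_apply_same, sgn_bnot]
    have : ∏ j ∈ S.erase i, sgn (flipAt i x j) = ∏ j ∈ S.erase i, sgn (x j) :=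
      Finset.prod_congr rfl fun j hj => by rw [flipAt_apply_ne (Finset.ne_of_mem_erase hj)]
    rw [this]; ring
  · rw [if_neg hi, one_mul]
    exact Finset.prod_congr rfl fun j hj => by rw [flipAt_apply_ne (by rintro rfl; exact hi hj)]

/-- **Coefficients of the flipped function**: `(g ∘ flip_i)^(S) = (-1)^{[i∈S]} ĝ(S)`. [cite: ODonnell2014, §1.2] -/
theorem cubeFourierCoeff_flipAt (g : (Fin m → Bool) → ℝ) (i : Fin m) (S : Finset (Fin m)) :
    cubeFourierCoeff (fun x => g (flipAt i x)) S = (if i ∈ S then -1 else 1) * cubeFourierCoeff g S := by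
  unfold cubeFourierCoeff
  rw [mul_div_assoc']
  congr 1
  have hinv : Function.Involutive (flipAt i : (Fin m → Bool) → (Fin m → Bool)) := flipAt_flipAt i
  have hc2 : ((if i ∈ S then (-1 : ℝ) else 1) * (if i ∈ S then (-1 : ℝ) else 1)) = 1 := by
    split_ifs <;> norm_num
  calc ∑ x, g (flipAt i x) * walsh S x
      = ∑ x, (fun y => (if i ∈ S then (-1 : ℝ) else 1) * (g y * walsh S y)) (flipAt i x) := by
          refine Finset.sum_congr rfl fun x _ => ?_
          simp only
          rw [walsh_flipAt]
          calc g (flipAt i x) * walsh S x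
              = ((if i ∈ S then (-1 : ℝ) else 1) * (if i ∈ S then (-1 : ℝ) else 1)) *
                  (g (flipAt i x) * walsh S x) := by rw [hc2, one_mul]
            _ = _ := by ring
    _ = ∑ y, (if i ∈ S then (-1 : ℝ) else 1) * (g y * walsh S y) :=
          Equiv.sum_comp (hinv.toPerm _) (fun y => (if i ∈ S then (-1 : ℝ) else 1) * (g y * walsh S y))
    _ = (if i ∈ S then (-1 : ℝ) else 1) * ∑ y, g y * walsh S y := by rw [← Finset.mul_sum]

/-- **`Inf_i` in Fourier** (O'Donnell Prop. 2.24, `{0,1}^m` form): `Σ_{S ∋ i} ĝ(S)² = #{x : f x ≠ f(x^{⊕i})}/2^m`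
for `g = sgn ∘ f`. [cite: ODonnell2014, Proposition 2.24] -/
theorem sum_sq_coeff_mem (f : (Fin m → Bool) → Bool) (i : Fin m) :
    ∑ S ∈ univ.filter (fun S : Finset (Fin m) => i ∈ S), cubeFourierCoeff (fun x => sgn (f x)) S ^ 2 =
      (#(univ.filter fun x : Fin m → Bool => f x ≠ f (flipAt i x)) : ℝ) / 2 ^ m := by
  set g : (Fin m → Bool) → ℝ := fun x => sgn (f x) with hg
  set h : (Fin m → Bool) → ℝ := fun x => g x - g (flipAt i x) with hh
  have hcoef : ∀ S, cubeFourierCoeff h S = if i ∈ S then 2 * cubeFourierCoeff g S else 0 := by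
    intro S
    rw [hh, cubeFourierCoeff_sub g (fun x => g (flipAt i x)), cubeFourierCoeff_flipAt]
    split_ifs <;> ring
  have hpars := sum_cubeFourierCoeff_sq h
  have hl : ∑ S, cubeFourierCoeff h S ^ 2 =
      4 * ∑ S ∈ univ.filter (fun S : Finset (Fin m) => i ∈ S), cubeFourierCoeff g S ^ 2 := by
    have e : ∀ S, cubeFourierCoeff h S ^ 2 = if i ∈ S then 4 * cubeFourierCoeff g S ^ 2 else 0 := by
      intro S; rw [hcoef]; split_ifs <;> ring
    simp_rw [e]
    rw [← Finset.sum_filter, Finset.mul_sum]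
  have hr : ∑ x, h x ^ 2 = 4 * (#(univ.filter fun x : Fin m → Bool => f x ≠ f (flipAt i x)) : ℝ) := by
    have e : ∀ x, h x ^ 2 = if f x ≠ f (flipAt i x) then 4 else 0 := by
      intro x
      simp only [hh, hg]
      cases f x <;> cases f (flipAt i x) <;> norm_num [sgn]
    simp_rw [e]
    rw [← Finset.sum_filter, Finset.sum_const, nsmul_eq_mul, mul_comm]
  rw [hl, hr] at hpars
  have h4 : (4 : ℝ) * ∑ S ∈ univ.filter (fun S : Finset (Fin m) => i ∈ S), cubeFourierCoeff g S ^ 2 =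
      4 * ((#(univ.filter fun x : Fin m → Bool => f x ≠ f (flipAt i x)) : ℝ) / 2 ^ m) := by
    rw [hpars]; ring
  linarith

/-- Each pivotal edge in direction `i` is seen from both endpoints:
`#{x : f x ≠ f(x^{⊕i})} = 2 · #{x : x_i = 0, f x ≠ f(x^{i→1})}`. [folklore] -/
theorem card_ne_flipAt (f : (Fin m → Bool) → Bool) (i : Fin m) :
    #(univ.filter fun x : Fin m → Bool => f x ≠ f (flipAt i x)) =
      2 * #(univ.filter fun x : Fin m → Bool => x i = false ∧ f x ≠ f (Function.update x i true)) := by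
  set A := univ.filter fun x : Fin m → Bool => f x ≠ f (flipAt i x) with hA
  set P := univ.filter fun x : Fin m → Bool => x i = false ∧ f x ≠ f (Function.update x i true) with hP
  have hsplit := Finset.card_filter_add_card_filter_not (s := A) (fun x : Fin m → Bool => x i = false)
  have hup : ∀ x : Fin m → Bool, x i = false → flipAt i x = Function.update x i true := by
    intro x hx; rw [flipAt, hx]; rfl
  have h1 : A.filter (fun x => x i = false) = P := by
    ext x
    simp only [hA, hP, Finset.mem_filter, Finset.mem_univ, true_and]
    constructor
    · rintro ⟨h, hx⟩; exact ⟨hx, by rwa [hup x hx] at h⟩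
    · rintro ⟨hx, h⟩; exact ⟨by rwa [hup x hx], hx⟩
  have h2 : #(A.filter (fun x => ¬ x i = false)) = #P := by
    refine Finset.card_bij' (fun x _ => flipAt i x) (fun x _ => flipAt i x) ?_ ?_
      (fun x _ => flipAt_flipAt i x) (fun x _ => flipAt_flipAt i x)
    · intro x hx
      simp only [hA, Finset.mem_filter, Finset.mem_univ, true_and] at hx
      obtain ⟨hne, hxi⟩ := hx
      have hxi' : x i = true := by cases hx : x i <;> simp_all
      have hfx : flipAt i x i = false := by rw [flipAt_apply_same, hxi']; rfl
      simp only [hP, Finset.mem_filter, Finset.mem_univ, true_and]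
      refine ⟨hfx, ?_⟩
      rw [← hup _ hfx, flipAt_flipAt]
      exact fun h => hne h.symm
    · intro x hx
      simp only [hP, Finset.mem_filter, Finset.mem_univ, true_and] at hx
      obtain ⟨hxi, hne⟩ := hx
      simp only [hA, Finset.mem_filter, Finset.mem_univ, true_and]
      refine ⟨?_, by rw [flipAt_apply_same, hxi]; decide⟩
      rw [flipAt_flipAt, hup x hxi]
      exact fun h => hne h.symm
  rw [h1, h2] at hsplit
  omega

/-- `Σ_{k=1}^{m} W^{≥k}[g] = Σ_S |S| ĝ(S)²`. [cite: Tal2017, Lemma 2.14] -/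
theorem sum_Icc_tailWeight (g : (Fin m → Bool) → ℝ) :
    ∑ k ∈ Finset.Icc 1 m, tailWeight g k = ∑ S : Finset (Fin m), (S.card : ℝ) * cubeFourierCoeff g S ^ 2 := by
  have h := sum_choose_mul_sq_eq_sum_tailWeight g (le_refl 1)
  simp only [Nat.choose_one_right, Nat.sub_self, Nat.choose_zero_right, Nat.cast_one, one_mul] at h
  rw [h]
  symm
  refine Finset.sum_nbij' (fun d => d + 1) (fun k => k - 1) ?_ ?_ ?_ ?_ ?_
  · intro d hd; simp only [Finset.mem_range] at hd; simp only [Finset.mem_Icc]; omega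
  · intro k hk; simp only [Finset.mem_Icc] at hk; simp only [Finset.mem_range]; omega
  · intro d hd; simp
  · intro k hk; simp only [Finset.mem_Icc] at hk; omega
  · intro d hd; rfl

/-- **Stub 4a (`InfluenceFourierStmt`) proved.** [cite: ODonnell2014, Proposition 2.24] -/
theorem influenceFourier :
    ∀ (m : ℕ) (f : (Fin m → Bool) → Bool),
      (∑ p ∈ (univ.filter fun p : (Fin m → Bool) × Fin m =>
          p.1 p.2 = false ∧ f p.1 ≠ f (Function.update p.1 p.2 true)),
        (1 / 2 : ℝ) ^ #(univ.filter fun i => p.1 i = true) *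
          (1 - 1 / 2 : ℝ) ^ (Fintype.card (Fin m) - 1 - #(univ.filter fun i => p.1 i = true))) =
      ∑ k ∈ Finset.Icc 1 m, tailWeight (fun x => sgn (f x)) k := by
  intro m f
  rcases Nat.eq_zero_or_pos m with rfl | hm
  · simp
  -- the pivotal set in direction `i`
  set P : Fin m → Finset (Fin m → Bool) :=
    fun i => univ.filter fun x : Fin m → Bool => x i = false ∧ f x ≠ f (Function.update x i true) with hP
  set F := univ.filter fun p : (Fin m → Bool) × Fin m =>
    p.1 p.2 = false ∧ f p.1 ≠ f (Function.update p.1 p.2 true) with hF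
  have hhalf : (1 / 2 : ℝ) ^ (m - 1) = 2 / 2 ^ m := by
    obtain ⟨m', rfl⟩ : ∃ m', m = m' + 1 := ⟨m - 1, by omega⟩
    rw [Nat.add_sub_cancel, one_div_pow, pow_succ, div_eq_div_iff (by positivity) (by positivity)]; ring
  -- Step 1: every term of the left sum is `(1/2)^{m-1}`
  have hL : ∑ p ∈ F, (1 / 2 : ℝ) ^ #(univ.filter fun i => p.1 i = true) *
        (1 - 1 / 2 : ℝ) ^ (Fintype.card (Fin m) - 1 - #(univ.filter fun i => p.1 i = true)) =
      ∑ p ∈ F, (1 / 2 : ℝ) ^ (m - 1) := by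
    refine Finset.sum_congr rfl fun p hp => ?_
    simp only [hF, Finset.mem_filter, Finset.mem_univ, true_and] at hp
    have hle : #(univ.filter fun i => p.1 i = true) ≤ m - 1 := by
      have hsub : (univ.filter fun i => p.1 i = true) ⊆ univ.erase p.2 := by
        intro i hi
        simp only [Finset.mem_filter, Finset.mem_univ, true_and] at hi
        exact Finset.mem_erase.2 ⟨fun h => by rw [h, hp.1] at hi; exact Bool.false_ne_true hi, mem_univ _⟩
      have := Finset.card_le_card hsub
      rwa [Finset.card_erase_of_mem (mem_univ _), Finset.card_univ, Fintype.card_fin] at this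
    rw [Fintype.card_fin, show (1 - 1 / 2 : ℝ) = 1 / 2 by norm_num, ← pow_add]
    congr 1
    omega
  -- Step 2: `#F = Σ_i #P_i`
  have hcardF : (#F : ℝ) = ∑ i : Fin m, (#(P i) : ℝ) := by
    have : #F = ∑ i : Fin m, #(P i) := by
      rw [hF, Finset.card_filter, Fintype.sum_prod_type_right]
      refine Finset.sum_congr rfl fun i _ => ?_
      rw [hP, Finset.card_filter]
    rw [this]; push_cast; rfl
  -- Step 3: the right side
  have hR : ∑ k ∈ Finset.Icc 1 m, tailWeight (fun x => sgn (f x)) k = ∑ i : Fin m, 2 * (#(P i) : ℝ) / 2 ^ m := by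
    rw [sum_Icc_tailWeight]
    have e : ∀ S : Finset (Fin m), (S.card : ℝ) * cubeFourierCoeff (fun x => sgn (f x)) S ^ 2 =
        ∑ i ∈ S, cubeFourierCoeff (fun x => sgn (f x)) S ^ 2 := by
      intro S; rw [Finset.sum_const, nsmul_eq_mul]
    simp_rw [e]
    rw [Finset.sum_comm' (t' := univ) (s' := fun i => univ.filter fun S : Finset (Fin m) => i ∈ S)
      (fun S i => by simp)]
    refine Finset.sum_congr rfl fun i _ => ?_
    rw [sum_sq_coeff_mem, card_ne_flipAt]
    push_cast; ring
  rw [hL, Finset.sum_const, nsmul_eq_mul, hcardF, hR, Finset.sum_mul]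
  refine Finset.sum_congr rfl fun i _ => ?_
  rw [hhalf]; ring

/-- **Registered v2 stub `stub_influenceFourier` (line `binomial-hybrid-influence-budget`) proved**:
`Σ_i #{x : g x ≠ g(x ⊕ e_i)}/2^N = Σ_{k=1}^{N} W^{≥k}[sgn ∘ g]` (statement verbatim; `Function.update x i (!x i)`
is `flipAt i x` by `rfl`). [cite: ODonnell2014, Proposition 2.24] -/
theorem influenceFourier_v2 (N : ℕ) (g : (Fin N → Bool) → Bool) :
    ∑ i : Fin N, (#(univ.filter fun x : Fin N → Bool => g x ≠ g (Function.update x i (!x i))) : ℝ) / 2 ^ N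
      = ∑ k ∈ Icc 1 N,
          LowDegree.tailWeight (fun x => Literature.Probability.RandomGraphs.LowDegree.sgn (g x)) k := by
  rw [sum_Icc_tailWeight]
  have e : ∀ S : Finset (Fin N), (S.card : ℝ) * cubeFourierCoeff (fun x => sgn (g x)) S ^ 2 =
      ∑ i ∈ S, cubeFourierCoeff (fun x => sgn (g x)) S ^ 2 := by
    intro S; rw [Finset.sum_const, nsmul_eq_mul]
  simp_rw [e]
  rw [Finset.sum_comm' (t' := univ) (s' := fun i => univ.filter fun S : Finset (Fin N) => i ∈ S)
    (fun S i => by simp)]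
  refine Finset.sum_congr rfl fun i _ => ?_
  rw [sum_sq_coeff_mem]
  rfl


end S4a

namespace S4b


open Finset Literature.Computability.Complexity
open Literature.Computability.Complexity.LowDegree (tailWeight tailWeight_nonneg)
open Literature.Probability.RandomGraphs.LowDegree (sgn)
open Literature.Computability.Complexity.ACForm

/-- **Core summation.** A layered formula of height `≤ d'` (`d' ≥ 2`), effective size `≤ M` (`M ≥ 1`) and bottom
fan-in `≤ 1` has `Σ_{k=1}^{m} W^{≥k} ≤ 8^{d'} cB^{d'} (logM M)^{d'-2} / ln 2` (Tal's per-level bound summed as a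
geometric series). [cite: Tal2017, Theorem 3.6] -/
theorem sum_tailWeight_le_core {m M d' : ℕ} (hM : 1 ≤ M) (hd' : 2 ≤ d') (f : ACForm m)
    (hh : f.height ≤ d') (hs : f.esize ≤ M) (hw : f.width ≤ 1) :
    ∑ k ∈ Finset.Icc 1 m, tailWeight (sgnEval f) k ≤
      (cA : ℝ) ^ d' * (cB : ℝ) ^ d' / Real.log 2 * ((logM M : ℕ) : ℝ) ^ (d' - 2) := by
  set ℓ : ℕ := logM M with hℓ
  have hℓ1 : 1 ≤ ℓ := one_le_logM hM
  have hl2 := Real.log_two_gt_d9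
  have hlog2 : 0 < Real.log 2 := by linarith
  have hcA : (0 : ℝ) < cA := by unfold cA; norm_num
  have hcB : (0 : ℝ) < cB := by unfold cB B0; norm_num
  have hℓpos : (0 : ℝ) < ℓ := by exact_mod_cast hℓ1
  -- the per-level bound from the in-tree Tal theorem
  have per : ∀ k, tailWeight (sgnEval f) k ≤ tailBound ℓ d' 1 k :=
    tailWeight_le_tailBound hM d' hd' f 1 le_rfl hℓ1 hh hs hw
  -- `tailBound ℓ d' 1 k = 8^{d'} r^k`, `r = e^{-a}`
  set a : ℝ := Real.log 2 / ((cB : ℝ) ^ d' * (ℓ : ℝ) ^ (d' - 2)) with ha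
  have hden : 0 < (cB : ℝ) ^ d' * (ℓ : ℝ) ^ (d' - 2) := by positivity
  have ha0 : 0 < a := div_pos hlog2 hden
  set r : ℝ := Real.exp (-a) with hr
  have hr0 : 0 ≤ r := (Real.exp_pos _).le
  have hr1 : r < 1 := Real.exp_lt_one_iff.2 (by linarith)
  have htb : ∀ k : ℕ, tailBound ℓ d' 1 k = (cA : ℝ) ^ d' * r ^ k := by
    intro k
    rw [hr, ← Real.exp_nat_mul, tailBound, Nat.cast_one, mul_one]
    congr 2
    rw [ha]
    ring
  -- geometric series
  have hIcc : Finset.Icc 1 m = Finset.Ico 1 (m + 1) := by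
    ext k; simp only [Finset.mem_Icc, Finset.mem_Ico]; omega
  have hgeom : ∑ k ∈ Finset.Icc 1 m, r ^ k ≤ r / (1 - r) := by
    rw [hIcc]
    simpa using geom_sum_Ico_le_of_lt_one (m := 1) (n := m + 1) hr0 hr1
  have hra : r / (1 - r) ≤ 1 / a := by
    have h1 : r * (a + 1) ≤ 1 := by
      calc r * (a + 1) ≤ r * Real.exp a := mul_le_mul_of_nonneg_left (Real.add_one_le_exp a) hr0
        _ = 1 := by rw [hr, ← Real.exp_add, neg_add_cancel, Real.exp_zero]
    rw [div_le_div_iff₀ (by linarith) ha0]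
    nlinarith
  calc ∑ k ∈ Finset.Icc 1 m, tailWeight (sgnEval f) k
      ≤ ∑ k ∈ Finset.Icc 1 m, (cA : ℝ) ^ d' * r ^ k :=
        Finset.sum_le_sum fun k _ => (per k).trans (le_of_eq (htb k))
    _ = (cA : ℝ) ^ d' * ∑ k ∈ Finset.Icc 1 m, r ^ k := by rw [Finset.mul_sum]
    _ ≤ (cA : ℝ) ^ d' * (1 / a) := mul_le_mul_of_nonneg_left (hgeom.trans hra) (by positivity)
    _ = (cA : ℝ) ^ d' * (cB : ℝ) ^ d' / Real.log 2 * (ℓ : ℝ) ^ (d' - 2) := by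
        rw [ha]; field_simp

/-- **Stub 4b (`TalInfluenceStmt`, line `russo-window-ladder`) proved**: the summed Fourier tails
`Σ_{k=1}^{m} W^{≥k}[sgn ∘ C]` of an `acBasis` circuit of `acDepth ≤ d` on `Fin m` are at most `K_d (log(|C|+2))^{d}`,
uniformly in `m`. [cite: Tal2017, Theorem 3.6] -/
theorem talInfluence :
    ∀ d : ℕ, ∃ K : ℝ, ∃ B : ℕ, ∀ (m : ℕ) (C : Circuit (Fin m)), C.IsOver acBasis → C.acDepth ≤ d →
      ∑ k ∈ Finset.Icc 1 m, tailWeight (fun x => sgn (C.eval x)) k ≤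
        K * Real.log ((C.size : ℝ) + 2) ^ B := by
  intro d
  refine ⟨(cA : ℝ) ^ (d + 2) * (cB : ℝ) ^ (d + 2) / Real.log 2 * (3 : ℝ) ^ d, d, fun m C hC hd => ?_⟩
  obtain ⟨f, hev, hh, hw, hsize⟩ := C.exists_acForm hC
  have hfun : (fun x => sgn (C.eval x)) = sgnEval f := by funext x; rw [sgnEval, hev]
  rw [hfun]
  set s : ℕ := C.size with hs
  have hM1 : 1 ≤ 2 * s + 1 := by omega
  have hl2 := Real.log_two_gt_d9
  have hlog2 : 0 < Real.log 2 := by linarith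
  have hcA : (0 : ℝ) < cA := by unfold cA; norm_num
  have hcB : (0 : ℝ) < cB := by unfold cB B0; norm_num
  have core := sum_tailWeight_le_core hM1 (show 2 ≤ d + 2 by omega) f (hh.trans (by omega))
    (hsize.trans (by omega)) hw
  rw [Nat.add_sub_cancel] at core
  set ℓ : ℕ := logM (2 * s + 1) with hℓ
  -- `ℓ ≤ 3 log(s+2)`
  have hs0 : (0 : ℝ) ≤ s := Nat.cast_nonneg _
  have hL0 : 0 ≤ Real.log ((s : ℝ) + 2) := Real.log_nonneg (by linarith)
  have hℓL : (ℓ : ℝ) ≤ 3 * Real.log ((s : ℝ) + 2) := by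
    have hpow : (2 : ℝ) ^ ℓ ≤ 2 * s + 2 := by
      have := Nat.pow_log_le_self 2 (show 2 * s + 1 + 1 ≠ 0 by omega)
      rw [hℓ, logM]
      exact_mod_cast this
    have h1 : (ℓ : ℝ) * Real.log 2 ≤ Real.log (2 * s + 2) := by
      rw [← Real.log_pow]; exact Real.log_le_log (by positivity) hpow
    have h2 : Real.log (2 * (s : ℝ) + 2) ≤ 2 * Real.log ((s : ℝ) + 2) := by
      have e : Real.log (((s : ℝ) + 2) ^ 2) = 2 * Real.log ((s : ℝ) + 2) := by
        rw [Real.log_pow]; norm_num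
      rw [← e]
      exact Real.log_le_log (by positivity) (by nlinarith)
    have h3 : (ℓ : ℝ) * Real.log 2 ≤ 3 * Real.log ((s : ℝ) + 2) * Real.log 2 := by nlinarith
    exact le_of_mul_le_mul_right h3 hlog2
  have hℓd : (ℓ : ℝ) ^ d ≤ (3 * Real.log ((s : ℝ) + 2)) ^ d := pow_le_pow_left₀ (Nat.cast_nonneg _) hℓL d
  calc ∑ k ∈ Finset.Icc 1 m, tailWeight (sgnEval f) k
      ≤ (cA : ℝ) ^ (d + 2) * (cB : ℝ) ^ (d + 2) / Real.log 2 * (ℓ : ℝ) ^ d := core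
    _ ≤ (cA : ℝ) ^ (d + 2) * (cB : ℝ) ^ (d + 2) / Real.log 2 * (3 * Real.log ((s : ℝ) + 2)) ^ d :=
        mul_le_mul_of_nonneg_left hℓd (by positivity)
    _ = (cA : ℝ) ^ (d + 2) * (cB : ℝ) ^ (d + 2) / Real.log 2 * (3 : ℝ) ^ d *
          Real.log ((s : ℝ) + 2) ^ d := by rw [mul_pow]; ring

/-- **Registered v2 stub `stub_boppanaTail` (line `binomial-hybrid-influence-budget`) proved**: for `d ≥ 1`,
an `acBasis` circuit of `acDepth ≤ d` with `≤ s` gates, `s ≥ 2`, has `Σ_{k=1}^{N} W^{≥k}[sgn ∘ C] ≤ K_d (log s)^{d-1}`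
(sharp Boppana exponent; `d' := d+1`, `M := 2s`, `ℓ ≤ 5 log s`). [cite: Tal2017, Theorem 3.6] -/
theorem boppanaTail (d : ℕ) (hd : 1 ≤ d) :
    ∃ K : ℝ, 0 < K ∧ ∀ (N s : ℕ) (C : Circuit (Fin N)),
      C.IsOver acBasis → C.acDepth ≤ d → C.size ≤ s → 2 ≤ s →
      ∑ k ∈ Icc 1 N,
          LowDegree.tailWeight (fun x => Literature.Probability.RandomGraphs.LowDegree.sgn (C.eval x)) k
        ≤ K * Real.log s ^ (d - 1) := by
  have hl2 := Real.log_two_gt_d9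
  have hlog2 : 0 < Real.log 2 := by linarith
  have hcA : (0 : ℝ) < cA := by unfold cA; norm_num
  have hcB : (0 : ℝ) < cB := by unfold cB B0; norm_num
  refine ⟨(cA : ℝ) ^ (d + 1) * (cB : ℝ) ^ (d + 1) / Real.log 2 * (5 : ℝ) ^ (d - 1), by positivity,
    fun N s C hC hdC hCs hs2 => ?_⟩
  obtain ⟨f, hev, hh, hw, hsize⟩ := C.exists_acForm hC
  have hfun : (fun x => sgn (C.eval x)) = sgnEval f := by funext x; rw [sgnEval, hev]
  rw [hfun]
  have hM1 : 1 ≤ 2 * s := by omega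
  have core := sum_tailWeight_le_core hM1 (show 2 ≤ d + 1 by omega) f (hh.trans (by omega))
    (hsize.trans (by omega)) hw
  rw [show d + 1 - 2 = d - 1 by omega] at core
  have hℓL : ((logM (2 * s) : ℕ) : ℝ) ≤ 5 * Real.log s := logM_two_mul_le hs2
  have hℓd : ((logM (2 * s) : ℕ) : ℝ) ^ (d - 1) ≤ (5 * Real.log s) ^ (d - 1) :=
    pow_le_pow_left₀ (Nat.cast_nonneg _) hℓL _
  calc ∑ k ∈ Finset.Icc 1 N, tailWeight (sgnEval f) k
      ≤ (cA : ℝ) ^ (d + 1) * (cB : ℝ) ^ (d + 1) / Real.log 2 * ((logM (2 * s) : ℕ) : ℝ) ^ (d - 1) := core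
    _ ≤ (cA : ℝ) ^ (d + 1) * (cB : ℝ) ^ (d + 1) / Real.log 2 * (5 * Real.log s) ^ (d - 1) :=
        mul_le_mul_of_nonneg_left hℓd (by positivity)
    _ = (cA : ℝ) ^ (d + 1) * (cB : ℝ) ^ (d + 1) / Real.log 2 * (5 : ℝ) ^ (d - 1) *
          Real.log s ^ (d - 1) := by rw [mul_pow]; ring


end S4b

/-! ### The five registered stubs (`sorry` lives ONLY in these five theorems) -/

/-- **Stub 1 — slice coupling (the lever; exact combinatorics, M).** For every Boolean `f` on `{0,1}^ι`
(`N = |ι|`), every `q ∈ [0,1]` and every `j ≤ N`: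
`|E_{μ_q} f − a_j(f)| ≤ Σ_{(x,i) ∈ upPivotal f} w_{q,j}(|x|) / ((N − |x|)·C(N,|x|))`.
Proof plan: `E_{μ_q} f = Σ_ℓ B_{N,q}(ℓ)·a_ℓ` (group `{f=1}` by weight; `Σ_ℓ B = 1`); the up-step coupling
`a_{ℓ+1} − a_ℓ = (#{up-edges from level ℓ with f(top)=1} − #{… f(bottom)=1})/((N−ℓ)C(N,ℓ))`
(every point of slice `ℓ` has `N−ℓ` up-neighbours, every point of slice `ℓ+1` has `ℓ+1` down-neighbours,
`(N−ℓ)C(N,ℓ) = (ℓ+1)C(N,ℓ+1)`), hence `|a_{ℓ+1} − a_ℓ| ≤ β_ℓ/((N−ℓ)C(N,ℓ))`; telescope `a_ℓ − a_j` along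
`[min(ℓ,j), max(ℓ,j))` and exchange sums: level `i` is crossed by exactly the `ℓ` of hybrid weight
`w_{q,j}(i)`. (= Filmus–Mossel, *Harmonicity and invariance on slices*, Lemma 8.2/8.3 unnormalised; Russo–Margulis
`I_q = N·Σ_ℓ P[Bin(N−1,q)=ℓ]·φ_ℓ` is the same double count. Brute-force exact for `N ≤ 8`: card + triage C1.)
[folklore] -/
theorem stub_sliceCoupling :
    ∀ (ι : Type) [Fintype ι] [DecidableEq ι] (f : (ι → Bool) → Bool) (q : ℝ), 0 ≤ q → q ≤ 1 →
      ∀ j : ℕ, j ≤ Fintype.card ι →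
        |prodAvg q f - sliceAvg f j| ≤
          ∑ p ∈ upPivotal f, hybridWeight (Fintype.card ι) q j (wt p.1) /
            (((Fintype.card ι - wt p.1 : ℕ) : ℝ) * ((Fintype.card ι).choose (wt p.1) : ℝ)) :=
  S1.sliceCoupling

/-- **Stub 2 — binomial hazard estimate (M).** There is an absolute `K₀` (`40/3` works) with: for
`0 < j < N`, `q = j/N` and every level `i < N`,
`w_{q,j}(i)/((N−i)C(N,i)) ≤ (K₀/√j) · q^{i+1}(1−q)^{N−1−i}`, i.e. `w_{q,j}(i) ≤ K₀ (i+1) B_{N,q}(i+1)/√j`.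
Proof plan: `B_{N,q}` is log-concave (`B(ℓ)² ≥ B(ℓ−1)B(ℓ+1)` from the ratio `(N−ℓ)q/((ℓ+1)(1−q))`), so
`P[X ≥ m]/B(m)` is non-increasing and `P[X ≤ m]/B(m)` non-decreasing in `m`; `j` is a mode of `Bin(N, j/N)`
and `B(j±1) ≥ B(j)/2`; Chebyshev (variance `j(1−j/N) ≤ j` as a finite sum) + unimodality give
`B(j) ≥ (3/4)/(4√j+1) ≥ 3/(20√j)`; for `i ≥ j`: `P[X ≥ i+1] ≤ B(i+1)/B(j+1) ≤ (40/3)√j·B(i+1)` and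
`√j ≤ (i+1)/√j`; for `i < j`: `P[X ≤ i] ≤ (40/3)√j·B(i)` and `j·B(i) ≤ (i+1)B(i+1)` (ratio `(N−i)j/(N−j) ≥ j`);
finally `(i+1)C(N,i+1) = (N−i)C(N,i)` (`Nat.choose_succ_right_eq`). (Sharp constant `→ √(2π)`, triage r1-2 T1.)
[folklore] -/
theorem stub_binomialHazard :
    ∃ K₀ : ℝ, 0 < K₀ ∧ ∀ (N j i : ℕ), 0 < j → j < N → i < N →
      hybridWeight N ((j : ℝ) / N) j i / (((N - i : ℕ) : ℝ) * (N.choose i : ℝ)) ≤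
        K₀ / Real.sqrt j * (((j : ℝ) / N) ^ (i + 1) * (1 - (j : ℝ) / N) ^ (N - 1 - i)) :=
  S2.binomialHazard

/-- **Stub 3 — AND-coin identity (exact, S/M).** For every Boolean `f` on `{0,1}^ι` and `0 ≤ q ≤ 1/2`:
`2q · I_q(f) = Σ_y μ_{2q}(y) · I_{1/2}(f_y)`, `f_y(z) = f(y ∧ z)`.
Proof plan (double count): an up-pivotal edge `(z,i)` of `f_y` needs `y_i = 1`, and then `x = y ∧ z ↦ (x,i)` is
an up-pivotal edge of `f` with exactly `2^{N−|y|}` preimages `z`; summing `(2q)^{|y|}(1−2q)^{N−|y|}·2^{N−|y|}`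
over `y ⊇ x ∪ {i}` gives `2^N q^{|x|+1}(1−q)^{N−1−|x|}` (binomial theorem on the complement), and
`I_{1/2}(f_y) = #upPivotal(f_y)·2^{1−N}`. Equivalently: `x = y ∧ z`, `y ∼ μ_{2q}`, `z ∼ μ_{1/2}` realises
`x ∼ μ_q` (a polynomial identity in `q`, true for all real `q`; stated on `[0,1/2]`). (Rossman 2008 Lemma 4.5's
`∧`-gadget, applied to the influence functional; brute-force exact: triage r1-1 (2), r1-3 C3.) [folklore] -/
theorem stub_andCoin :
    ∀ (ι : Type) [Fintype ι] [DecidableEq ι] (f : (ι → Bool) → Bool) (q : ℝ), 0 ≤ q → 2 * q ≤ 1 →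
      2 * q * biasedInfluence q f =
        ∑ y : ι → Bool, prodWeight (2 * q) y *
          biasedInfluence (1 / 2) (fun z => f (fun i => y i && z i)) :=
  S3.andCoin

/-- **Stub 4a — Fourier formula for the total influence (exact identity, M).** For every Boolean `f` on `{0,1}^m`:
`I[f] = #upPivotal(f) · 2^{1−m} = Σ_{k=1}^{m} W^{≥k}[g]`, `g = sgn ∘ f` (`sgn b = if b then −1 else 1`,
`W^{≥k}[g] = tailWeight g k = Σ_{|S| ≥ k} ĝ(S)²`, `ĝ = cubeFourierCoeff g`). The left side is `biasedInfluence (1/2) f`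
written out (`(1/2)^{|x|} (1 − 1/2)^{m−1−|x|} = 2^{1−m}` on up-pivotal `(x,i)`).
Proof plan (O'Donnell 2014, Prop. 2.24 / Thm 2.38): for each `i`, `Inf_i[g] = Pr_x[f x ≠ f (x ⊕ e_i)] = E[(D_i g)²]` with
`D_i g (x) = (g(x^{i→0}) − g(x^{i→1}))/2 ∈ {0, ±1}`, whose expansion is `Σ_{S ∌ i} ĝ(S ∪ {i}) χ_S`, so by Parseval
(`sum_cubeFourierCoeff_sq`) `Inf_i[g] = Σ_{S ∋ i} ĝ(S)²`; summing over `i`: `Σ_S |S| ĝ(S)² = Σ_{k=1}^{m} Σ_{|S| ≥ k} ĝ(S)²`;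
and `Σ_i Pr_x[f x ≠ f(x ⊕ e_i)] = Σ_i 2·#{x : x_i = 0, f x ≠ f(x^{i→1})}/2^m`. Alternatively, directly:
`ĝ(S) = 2^{−m} Σ_x g(x) χ_S(x)` and `Σ_S |S| χ_S(x) χ_S(y)` computed coordinatewise. [cite: ODonnell2014, Proposition 2.24] -/
theorem stub_influenceFourier :
    ∀ (m : ℕ) (f : (Fin m → Bool) → Bool),
      (∑ p ∈ (univ.filter fun p : (Fin m → Bool) × Fin m =>
          p.1 p.2 = false ∧ f p.1 ≠ f (Function.update p.1 p.2 true)),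
        (1 / 2 : ℝ) ^ #(univ.filter fun i => p.1 i = true) *
          (1 - 1 / 2 : ℝ) ^ (Fintype.card (Fin m) - 1 - #(univ.filter fun i => p.1 i = true))) =
      ∑ k ∈ Finset.Icc 1 m, tailWeight (fun x => sgn (f x)) k :=
  S4a.influenceFourier

/-- **Stub 4b — summed Fourier tails of bounded-depth circuits from the in-tree Tal theorem (M).** For every depth `d`
there are `K, B` with: every circuit `C` over `acBasis` on `Fin m` of `acDepth ≤ d` has
`Σ_{k=1}^{m} W^{≥k}[sgn ∘ C.eval] ≤ K · (log(|C|+2))^B` (Boppana 1997: `O((log s)^{d−1})`; LMN 1993: `O((log s)^d)`; any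
polylog suffices downstream).
Proof plan: `Circuit.exists_acForm` gives a layered formula `F` with `F.eval = C.eval`, height `≤ acDepth+1 ≤ d+1`,
width `≤ 1`, esize `≤ 2s` (`s = C.size`); apply `ACForm.tailWeight_le_tailBound` with `M := 2s+1 ≥ 1`, depth
parameter `d' := d+2 ≥ 2` (height `≤ d'`), `t := 1 ≤ logM M` (`one_le_logM`): `W^{≥k}[sgnEval F] ≤ tailBound (logM M) d' 1 k
= 8^{d'} · exp(−k ln 2/(cB^{d'} ℓ^{d'−2}))`, `ℓ = logM M = ⌊log₂(2s+2)⌋ ≤ 3 log(s+2)`; with `R := cB^{d'} ℓ^{d}/ln 2` and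
`W^{≥k} ≤ 1` (`tailWeight_le_one`, `sgnEval_sq`): `Σ_{k=1}^{m} W^{≥k} ≤ #{k : 8^{d'} e^{−k/R} > 1} + Σ_{j ≥ 0} e^{−j/R}
≤ R·d'·ln 8 + 1 + (R + 1)`, a polynomial of degree `d` in `ℓ`, hence `≤ K_d (log(s+2))^d`. (`Real.exp` geometric
series: `Real.summable_geometric_of_lt_one` / `tsum_geometric_of_lt_one` or a direct `Finset` bound; compare
`l1Level_le_of_tailWeight_le` in `FourierTails.lean`, which sums the same tails against `C(k', k)`.)
[cite: Tal2017, Theorem 3.6; Boppana1997] -/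
theorem stub_talInfluence :
    ∀ d : ℕ, ∃ K : ℝ, ∃ B : ℕ, ∀ (m : ℕ) (C : Circuit (Fin m)), C.IsOver acBasis → C.acDepth ≤ d →
      ∑ k ∈ Finset.Icc 1 m, tailWeight (fun x => sgn (C.eval x)) k ≤ K * Real.log ((C.size : ℝ) + 2) ^ B :=
  S4b.talInfluence

/-! ### Name-keyed aliases of the five statements (the hypotheses of the composition) -/
namespace Registered

/-- Alias of `SliceCouplingStmt` keyed by the registered stub name. [folklore] -/
abbrev stub_sliceCoupling : Prop := SliceCouplingStmt
/-- Alias of `BinomialHazardStmt` keyed by the registered stub name. [folklore] -/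
abbrev stub_binomialHazard : Prop := BinomialHazardStmt
/-- Alias of `AndCoinStmt` keyed by the registered stub name. [folklore] -/
abbrev stub_andCoin : Prop := AndCoinStmt
/-- Alias of `InfluenceFourierStmt` keyed by the registered stub name. [folklore] -/
abbrev stub_influenceFourier : Prop := InfluenceFourierStmt
/-- Alias of `TalInfluenceStmt` keyed by the registered stub name. [folklore] -/
abbrev stub_talInfluence : Prop := TalInfluenceStmt

end Registered

/-! ### Proved glue: elementary facts on the cube -/

section Glue

variable {ι : Type} [Fintype ι]

/-- A point with a zero coordinate has weight `< N`. [folklore] -/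
theorem wt_lt_card_of_mem_upPivotal [DecidableEq ι] {f : (ι → Bool) → Bool} {p : (ι → Bool) × ι}
    (hp : p ∈ upPivotal f) : wt p.1 < Fintype.card ι := by
  rw [upPivotal, mem_filter] at hp
  rw [wt, ← Finset.card_univ (α := ι)]
  refine Finset.card_lt_card (Finset.filter_ssubset.2 ⟨p.2, mem_univ _, ?_⟩)
  rw [hp.2.1]
  exact Bool.false_ne_true

/-- `μ_q` weights are nonnegative for `q ∈ [0,1]`. [folklore] -/
theorem prodWeight_nonneg {q : ℝ} (hq0 : 0 ≤ q) (hq1 : q ≤ 1) (x : ι → Bool) : 0 ≤ prodWeight q x :=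
  mul_nonneg (pow_nonneg hq0 _) (pow_nonneg (sub_nonneg.2 hq1) _)

/-- Product form of the `μ_q` weight. [folklore] -/
theorem prodWeight_eq_prod (q : ℝ) (x : ι → Bool) :
    prodWeight q x = ∏ i, (if x i = true then q else 1 - q) := by
  have hc : #(univ.filter fun i => ¬ x i = true) = Fintype.card ι - wt x := by
    have h := Finset.card_filter_add_card_filter_not (s := (univ : Finset ι)) (fun i => x i = true)
    rw [Finset.card_univ] at h
    rw [wt]
    omega
  rw [Finset.prod_ite, Finset.prod_const, Finset.prod_const, hc]
  rfl

/-- Total mass `Σ_x μ_q(x) = 1`. [folklore] -/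
theorem sum_prodWeight [DecidableEq ι] (q : ℝ) : ∑ x : ι → Bool, prodWeight q x = 1 := by
  simp_rw [prodWeight_eq_prod]
  rw [sum_boolVec_prod (fun _ b => if b = true then q else 1 - q)]
  simp

end Glue

/-! ### Proved glue: S1 + S2 ⇒ the hybrid inequality `|E_{j/N} f − a_j f| ≤ K₀ (q I_q f)/√j` -/

/-- **S1 + S2.** At the matched density `q = j/N` (`0 < j < N`): `|E_q f − a_j f| ≤ (K₀/√j)·q·I_q(f)`.
[folklore] -/
theorem hybrid_le (h1 : SliceCouplingStmt) {K₀ : ℝ}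
    (h2 : ∀ (N j i : ℕ), 0 < j → j < N → i < N →
      hybridWeight N ((j : ℝ) / N) j i / (((N - i : ℕ) : ℝ) * (N.choose i : ℝ)) ≤
        K₀ / Real.sqrt j * (((j : ℝ) / N) ^ (i + 1) * (1 - (j : ℝ) / N) ^ (N - 1 - i)))
    {ι : Type} [Fintype ι] [DecidableEq ι] (f : (ι → Bool) → Bool) {j : ℕ} (hj0 : 0 < j)
    (hjN : j < Fintype.card ι) :
    |prodAvg ((j : ℝ) / (Fintype.card ι : ℝ)) f - sliceAvg f j| ≤
      K₀ / Real.sqrt j * ((j : ℝ) / (Fintype.card ι : ℝ)) *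
        biasedInfluence ((j : ℝ) / (Fintype.card ι : ℝ)) f := by
  have hNpos : (0 : ℝ) < (Fintype.card ι : ℝ) := by exact_mod_cast hj0.trans hjN
  have hq0 : 0 ≤ (j : ℝ) / (Fintype.card ι : ℝ) := div_nonneg (Nat.cast_nonneg _) hNpos.le
  have hq1 : (j : ℝ) / (Fintype.card ι : ℝ) ≤ 1 := by
    rw [div_le_one hNpos]; exact_mod_cast hjN.le
  calc |prodAvg ((j : ℝ) / (Fintype.card ι : ℝ)) f - sliceAvg f j|
      ≤ ∑ p ∈ upPivotal f, hybridWeight (Fintype.card ι) ((j : ℝ) / (Fintype.card ι : ℝ)) j (wt p.1) /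
          (((Fintype.card ι - wt p.1 : ℕ) : ℝ) * ((Fintype.card ι).choose (wt p.1) : ℝ)) :=
        h1 ι f _ hq0 hq1 j hjN.le
    _ ≤ ∑ p ∈ upPivotal f, K₀ / Real.sqrt j *
          (((j : ℝ) / (Fintype.card ι : ℝ)) ^ (wt p.1 + 1) *
            (1 - (j : ℝ) / (Fintype.card ι : ℝ)) ^ (Fintype.card ι - 1 - wt p.1)) :=
        Finset.sum_le_sum fun p hp => h2 (Fintype.card ι) j (wt p.1) hj0 hjN (wt_lt_card_of_mem_upPivotal hp)
    _ = K₀ / Real.sqrt j * ((j : ℝ) / (Fintype.card ι : ℝ)) *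
          biasedInfluence ((j : ℝ) / (Fintype.card ι : ℝ)) f := by
        rw [biasedInfluence, Finset.mul_sum]
        refine Finset.sum_congr rfl fun p _ => ?_
        ring

/-! ### Proved glue: S3 + S4 + restrictions ⇒ the biased influence budget `q·I_q(C) ≤ K (log(|C|+3))^B / 2` -/

/-- **S3 + S4.** For `C` over `acBasis` of `acDepth ≤ d` and `0 ≤ q ≤ 1/2`: `q·I_q(C) ≤ (K/2)(log(|C|+3))^B`,
where `(K, B)` are Boppana constants for depth `d+1` (restrictions may turn `C` into a one-gate constant). Uses
`Circuit.exists_restrict` (the 0-restriction `y ∧ ·` is a circuit of size `≤ max |C| 1`, `acDepth ≤ max d 1`) and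
`Σ_y μ_{2q}(y) = 1`. [folklore] -/
theorem biased_le (h3 : AndCoinStmt) {d B : ℕ} {K : ℝ} (hK : 0 ≤ K)
    (h4 : ∀ (ι : Type) [Fintype ι] [DecidableEq ι] (C : Circuit ι), C.IsOver acBasis →
      C.acDepth ≤ d + 1 → biasedInfluence (1 / 2) C.eval ≤ K * Real.log ((C.size : ℝ) + 2) ^ B)
    {ι : Type} [Fintype ι] [DecidableEq ι] (C : Circuit ι) (hC : C.IsOver acBasis)
    (hd : C.acDepth ≤ d) {q : ℝ} (hq0 : 0 ≤ q) (hq : 2 * q ≤ 1) :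
    q * biasedInfluence q C.eval ≤ K / 2 * Real.log ((C.size : ℝ) + 3) ^ B := by
  have key : ∀ y : ι → Bool,
      biasedInfluence (1 / 2) (fun z => C.eval (fun i => y i && z i)) ≤
        K * Real.log ((C.size : ℝ) + 3) ^ B := by
    intro y
    obtain ⟨C', hB', hs', hd', he'⟩ :=
      C.exists_restrict hC (fun i => if y i = true then none else some false)
    have hfun : (fun z => C.eval (fun i => y i && z i)) = C'.eval := by
      funext z
      rw [he']
      congr 1
      funext i
      cases hy : y i <;> simp [restrictInput, hy]
    rw [hfun]
    have hd1 : C'.acDepth ≤ d + 1 := hd'.trans (max_le (hd.trans (Nat.le_succ d)) (by omega))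
    refine (h4 ι C' hB' hd1).trans ?_
    have hsz0 : (0 : ℝ) ≤ (C'.size : ℝ) := Nat.cast_nonneg _
    have hsz : (C'.size : ℝ) + 2 ≤ (C.size : ℝ) + 3 := by
      have h1 : C'.size ≤ C.size + 1 := hs'.trans (max_le (Nat.le_succ _) (by omega))
      have h2 : (C'.size : ℝ) ≤ (C.size : ℝ) + 1 := by exact_mod_cast h1
      linarith
    exact mul_le_mul_of_nonneg_left
      (pow_le_pow_left₀ (Real.log_nonneg (by linarith)) (Real.log_le_log (by linarith) hsz) B) hK
  have hw0 : ∀ y : ι → Bool, 0 ≤ prodWeight (2 * q) y := fun y =>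
    prodWeight_nonneg (by linarith) hq y
  have hsum : 2 * q * biasedInfluence q C.eval ≤ K * Real.log ((C.size : ℝ) + 3) ^ B := by
    rw [h3 ι C.eval q hq0 hq]
    calc ∑ y : ι → Bool, prodWeight (2 * q) y *
          biasedInfluence (1 / 2) (fun z => C.eval (fun i => y i && z i))
        ≤ ∑ y : ι → Bool, prodWeight (2 * q) y * (K * Real.log ((C.size : ℝ) + 3) ^ B) :=
          Finset.sum_le_sum fun y _ => mul_le_mul_of_nonneg_left (key y) (hw0 y)
      _ = K * Real.log ((C.size : ℝ) + 3) ^ B := by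
          rw [← Finset.sum_mul, sum_prodWeight, one_mul]
  linarith

/-! ### Proved glue: index transport and Boppana's bound from S4a + S4b -/

section Transport

variable {ι κ : Type} [Fintype ι] [Fintype κ]

/-- The weight is invariant under renaming the coordinates along an equivalence. [folklore] -/
theorem wt_comp_equiv (e : ι ≃ κ) (x : ι → Bool) : wt (fun k => x (e.symm k)) = wt x := by
  unfold wt
  rw [← Finset.card_map e.toEmbedding]
  congr 1
  ext k
  simp only [Finset.mem_filter, Finset.mem_univ, true_and, Finset.mem_map_equiv, Equiv.coe_toEmbedding]

variable [DecidableEq ι] [DecidableEq κ]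

/-- **Index transport.** The biased influence is invariant under renaming the coordinates along an equivalence
`e : ι ≃ κ` (the up-pivotal edges correspond under `(x, i) ↦ (x ∘ e⁻¹, e i)`, weights and `N` are preserved). [folklore] -/
theorem biasedInfluence_comp_equiv (e : ι ≃ κ) (q : ℝ) (g : (ι → Bool) → Bool) :
    biasedInfluence q (fun u : κ → Bool => g (fun i => u (e i))) = biasedInfluence q g := by
  classical
  have hcard : Fintype.card κ = Fintype.card ι := Fintype.card_congr e.symm
  let ψ : (ι → Bool) × ι ≃ (κ → Bool) × κ := (e.arrowCongr (Equiv.refl Bool)).prodCongr e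
  have hψ : ∀ p : (ι → Bool) × ι, ψ p = (fun k => p.1 (e.symm k), e p.2) := fun p => rfl
  have hupd : ∀ (x : ι → Bool) (i i' : ι),
      Function.update (fun k => x (e.symm k)) (e i) true (e i') = Function.update x i true i' := by
    intro x i i'
    rw [Function.update_apply_equiv_apply]
    simp [Function.comp_def]
  have hmem : ∀ p : (ι → Bool) × ι,
      p ∈ upPivotal g ↔ ψ p ∈ upPivotal (fun u : κ → Bool => g (fun i => u (e i))) := by
    intro p
    rw [hψ]
    simp only [upPivotal, Finset.mem_filter, Finset.mem_univ, true_and, Equiv.symm_apply_apply, hupd]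
  have hw : ∀ p : (ι → Bool) × ι, wt (ψ p).1 = wt p.1 := fun p => by rw [hψ]; exact wt_comp_equiv e p.1
  symm
  unfold biasedInfluence
  refine Finset.sum_equiv ψ hmem (fun p _ => ?_)
  rw [hw, hcard]

end Transport

/-- **S4a + S4b ⇒ Boppana's bound on any finite index type.** Transport `C` to `Fin N` along `Fintype.equivFin ι`
(`Circuit.mapInputs`: same size, basis, `acDepth`; `eval_mapInputs`), rewrite the influence by the Fourier formula (S4a)
and bound the summed tails by S4b. [folklore] -/
theorem boppana_of (hF : InfluenceFourierStmt) (hT : TalInfluenceStmt) : BoppanaStmt := by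
  intro d
  obtain ⟨K, B, hKB⟩ := hT d
  refine ⟨K, B, fun ι _ _ C hC hd => ?_⟩
  set e := Fintype.equivFin ι with he
  have hev : (C.mapInputs e).eval = fun u => C.eval (fun i => u (e i)) := funext (Circuit.eval_mapInputs e C)
  have h1 : biasedInfluence (1 / 2) C.eval = biasedInfluence (1 / 2) (C.mapInputs e).eval := by
    rw [hev, biasedInfluence_comp_equiv e]
  have h2 : biasedInfluence (1 / 2) (C.mapInputs e).eval =
      ∑ k ∈ Finset.Icc 1 (Fintype.card ι), tailWeight (fun x => sgn ((C.mapInputs e).eval x)) k :=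
    hF (Fintype.card ι) (C.mapInputs e).eval
  have h3 := hKB (Fintype.card ι) (C.mapInputs e) (hC.mapInputs e) (by simpa using hd)
  rw [Circuit.size_mapInputs] at h3
  rw [h1, h2]
  exact h3

/-! ### Proved glue: the rate `polylog(j)/√j → 0` -/

/-- For fixed `c, B` and `M ≥ 0`: `M·(log(j^c+3))^B/√j ≤ ε` for all large `j`. [folklore] -/
theorem rate_eventually (c B : ℕ) {M ε : ℝ} (hM : 0 ≤ M) (hε : 0 < ε) :
    ∃ j₀ : ℕ, 1 ≤ j₀ ∧ ∀ j : ℕ, j₀ ≤ j →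
      M * Real.log ((j : ℝ) ^ c + 3) ^ B / Real.sqrt j ≤ ε := by
  have hlo := isLittleO_log_rpow_rpow_atTop (B : ℝ) (by norm_num : (0 : ℝ) < 1 / 2)
  have ht : Tendsto (fun j : ℕ => Real.log (j : ℝ) ^ (B : ℝ) / (j : ℝ) ^ (1 / 2 : ℝ)) atTop (nhds 0) :=
    hlo.tendsto_div_nhds_zero.comp tendsto_natCast_atTop_atTop
  set L : ℝ := M * ((c : ℝ) + 2) ^ B + 1 with hL
  have hLpos : 0 < L := by rw [hL]; positivity
  have hε' : 0 < ε / L := div_pos hε hLpos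
  obtain ⟨j₁, hj₁⟩ := eventually_atTop.1 (ht.eventually (gt_mem_nhds hε'))
  refine ⟨max j₁ 2, le_max_of_le_right (by norm_num), fun j hj => ?_⟩
  have hj2 : 2 ≤ j := (le_max_right _ _).trans hj
  have hjr : (2 : ℝ) ≤ j := by exact_mod_cast hj2
  have hjpos : (0 : ℝ) < j := by linarith
  have hratio := hj₁ j ((le_max_left _ _).trans hj)
  rw [Real.rpow_natCast, ← Real.sqrt_eq_rpow] at hratio
  have hlogj : 0 ≤ Real.log j := Real.log_nonneg (by linarith)
  have hpow_le : (j : ℝ) ^ c + 3 ≤ (j : ℝ) ^ (c + 2) := by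
    have h1 : (1 : ℝ) ≤ (j : ℝ) ^ c := one_le_pow₀ (by linarith)
    have h2 : (j : ℝ) ^ (c + 2) = (j : ℝ) ^ c * ((j : ℝ) * j) := by ring
    have h3 : (4 : ℝ) ≤ (j : ℝ) * j := by nlinarith
    have h4 : (j : ℝ) ^ c * 4 ≤ (j : ℝ) ^ c * ((j : ℝ) * j) :=
      mul_le_mul_of_nonneg_left h3 (zero_le_one.trans h1)
    rw [h2]
    linarith
  have hlog_le : Real.log ((j : ℝ) ^ c + 3) ≤ ((c : ℝ) + 2) * Real.log j := by
    calc Real.log ((j : ℝ) ^ c + 3) ≤ Real.log ((j : ℝ) ^ (c + 2)) :=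
          Real.log_le_log (by positivity) hpow_le
      _ = ((c + 2 : ℕ) : ℝ) * Real.log j := Real.log_pow _ _
      _ = ((c : ℝ) + 2) * Real.log j := by push_cast; ring
  have hjc0 : (0 : ℝ) ≤ (j : ℝ) ^ c := by positivity
  have hlog0 : 0 ≤ Real.log ((j : ℝ) ^ c + 3) := Real.log_nonneg (by linarith)
  have hpowB : Real.log ((j : ℝ) ^ c + 3) ^ B ≤ ((c : ℝ) + 2) ^ B * Real.log j ^ B := by
    rw [← mul_pow]; exact pow_le_pow_left₀ hlog0 hlog_le B
  have hsqrt : 0 < Real.sqrt j := Real.sqrt_pos.2 hjpos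
  calc M * Real.log ((j : ℝ) ^ c + 3) ^ B / Real.sqrt j
      ≤ M * (((c : ℝ) + 2) ^ B * Real.log j ^ B) / Real.sqrt j :=
        div_le_div_of_nonneg_right (mul_le_mul_of_nonneg_left hpowB hM) hsqrt.le
    _ = (M * ((c : ℝ) + 2) ^ B) * (Real.log j ^ B / Real.sqrt j) := by ring
    _ ≤ L * (Real.log j ^ B / Real.sqrt j) :=
        mul_le_mul_of_nonneg_right (by rw [hL]; linarith) (div_nonneg (pow_nonneg hlogj _) hsqrt.le)
    _ ≤ L * (ε / L) := mul_le_mul_of_nonneg_left hratio.le hLpos.le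
    _ = ε := mul_div_cancel₀ ε hLpos.ne'

/-! ### Proved glue: S1–S4 ⇒ `SliceIndist` -/

/-- **S1 + S2 + S3 + S4 ⇒ C⁺.** With `(K₀)` from S2 and `(K, B)` from S4 at depth `d+1`:
`|E_{j/N} C − a_j C| ≤ (K₀/√j)·q·I_q(C) ≤ K₀·(max K 0)/2 · (log(j^c+3))^B/√j ≤ ε` for `j ≥ j₀`. [folklore] -/
theorem sliceIndist_of (h1 : SliceCouplingStmt) (h2 : BinomialHazardStmt) (h3 : AndCoinStmt)
    (h4 : BoppanaStmt) : SliceIndist := by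
  intro d c ε hε
  obtain ⟨K₀, hK₀, h2'⟩ := h2
  obtain ⟨K, B, h4'⟩ := h4 (d + 1)
  have hK' : 0 ≤ max K 0 := le_max_right _ _
  have h4'' : ∀ (ι : Type) [Fintype ι] [DecidableEq ι] (C : Circuit ι), C.IsOver acBasis →
      C.acDepth ≤ d + 1 → biasedInfluence (1 / 2) C.eval ≤ max K 0 * Real.log ((C.size : ℝ) + 2) ^ B := by
    intro ι _ _ C hC hdC
    refine (h4' ι C hC hdC).trans (mul_le_mul_of_nonneg_right (le_max_left _ _) ?_)
    have : (0 : ℝ) ≤ (C.size : ℝ) := Nat.cast_nonneg _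
    exact pow_nonneg (Real.log_nonneg (by linarith)) _
  obtain ⟨j₀, hj₀, hrate⟩ :=
    rate_eventually c B (M := K₀ * (max K 0 / 2)) (mul_nonneg hK₀.le (div_nonneg hK' two_pos.le)) hε
  refine ⟨j₀, fun ι _ _ j hj h2j C hC hd hs => ?_⟩
  have hj1 : 0 < j := by omega
  have hjN : j < Fintype.card ι := by omega
  have hNpos : (0 : ℝ) < (Fintype.card ι : ℝ) := by exact_mod_cast hj1.trans hjN
  have hq0 : 0 ≤ (j : ℝ) / (Fintype.card ι : ℝ) := div_nonneg (Nat.cast_nonneg _) hNpos.le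
  have hq2 : 2 * ((j : ℝ) / (Fintype.card ι : ℝ)) ≤ 1 := by
    rw [mul_div_assoc', div_le_one hNpos]; exact_mod_cast h2j
  have hA := hybrid_le h1 h2' C.eval hj1 hjN
  have hB := biased_le h3 hK' h4'' C hC hd hq0 hq2
  have hsqrt : 0 ≤ K₀ / Real.sqrt j := div_nonneg hK₀.le (Real.sqrt_nonneg _)
  have hsize0 : (0 : ℝ) ≤ (C.size : ℝ) := Nat.cast_nonneg _
  have hsize : (C.size : ℝ) + 3 ≤ (j : ℝ) ^ c + 3 := by
    have : (C.size : ℝ) ≤ (j : ℝ) ^ c := by exact_mod_cast hs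
    linarith
  calc |prodAvg ((j : ℝ) / (Fintype.card ι : ℝ)) C.eval - sliceAvg C.eval j|
      ≤ K₀ / Real.sqrt j * ((j : ℝ) / (Fintype.card ι : ℝ)) *
          biasedInfluence ((j : ℝ) / (Fintype.card ι : ℝ)) C.eval := hA
    _ = K₀ / Real.sqrt j * (((j : ℝ) / (Fintype.card ι : ℝ)) *
          biasedInfluence ((j : ℝ) / (Fintype.card ι : ℝ)) C.eval) := by ring
    _ ≤ K₀ / Real.sqrt j * (max K 0 / 2 * Real.log ((C.size : ℝ) + 3) ^ B) :=
        mul_le_mul_of_nonneg_left hB hsqrt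
    _ ≤ K₀ / Real.sqrt j * (max K 0 / 2 * Real.log ((j : ℝ) ^ c + 3) ^ B) := by
        refine mul_le_mul_of_nonneg_left (mul_le_mul_of_nonneg_left ?_ (div_nonneg hK' two_pos.le)) hsqrt
        exact pow_le_pow_left₀ (Real.log_nonneg (by linarith)) (Real.log_le_log (by linarith) hsize) B
    _ = K₀ * (max K 0 / 2) * Real.log ((j : ℝ) ^ c + 3) ^ B / Real.sqrt j := by ring
    _ ≤ ε := hrate j hj


/-! ### Proved glue: the transfer `SliceIndist → Hyp → Conc` (the reduction; formerly stub S5) -/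

section Transfer

/-- Edge variables of `K_n` (the input type of the crux's circuits). [folklore] -/
abbrev Edge (n : ℕ) : Type := (⊤ : SimpleGraph (Fin n)).edgeSet

/-- `M^{3/4} ≤ M/2` for `M ≥ 16`. [folklore] -/
theorem rpow_three_quarters_le_half {M : ℝ} (hM : 16 ≤ M) : M ^ ((3 : ℝ) / 4) ≤ M / 2 := by
  have hM0 : 0 < M := by linarith
  have h1 : M ^ ((3 : ℝ) / 4) = M * M ^ (-(1 : ℝ) / 4) := by
    rw [show (3 : ℝ) / 4 = 1 + -(1 : ℝ) / 4 by norm_num, Real.rpow_add hM0, Real.rpow_one]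
  have h2 : M ^ (-(1 : ℝ) / 4) ≤ (16 : ℝ) ^ (-(1 : ℝ) / 4) :=
    Real.rpow_le_rpow_of_nonpos (by norm_num) hM (by norm_num)
  have h3 : (16 : ℝ) ^ (-(1 : ℝ) / 4) = 1 / 2 := by
    have h16 : (16 : ℝ) = (2 : ℝ) ^ (4 : ℝ) := by
      rw [show (4 : ℝ) = ((4 : ℕ) : ℝ) by norm_num, Real.rpow_natCast]; norm_num
    rw [h16, ← Real.rpow_mul (by norm_num : (0 : ℝ) ≤ 2),
      show (4 : ℝ) * (-(1 : ℝ) / 4) = -1 by norm_num, Real.rpow_neg_one]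
    norm_num
  rw [h1]
  calc M * M ^ (-(1 : ℝ) / 4) ≤ M * (1 / 2) := by
        rw [← h3]; exact mul_le_mul_of_nonneg_left h2 hM0.le
    _ = M / 2 := by ring

/-- **Window arithmetic** (this is where `3 ≤ k` and the centrality clause — load-bearing by the Disproof's
`not_innerConcNoWindow` / `not_innerConcWindowAbove` — are used): eventually in `n`, every central `j`
(`|j − m_k(n)| ≤ m_k(n)^{3/4}`) satisfies `j₀ ≤ j`, `n ≤ 5j` and `2j ≤ C(n,2)`. Proof: `m_k ≥ C(n,2)·n^{-1} − 1 =
(n−3)/2` (`n^{-2/(k-1)} ≥ n^{-1}`), `m_k^{3/4} ≤ m_k/2` once `m_k ≥ 16`, and `m_k ≤ C(n,2)·n^{-2/(k-1)} ≤ C(n,2)/4`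
eventually. [folklore] -/
theorem window_eventually {k : ℕ} (hk : 3 ≤ k) (j₀ : ℕ) :
    ∀ᶠ n : ℕ in atTop, ∀ j : ℕ, |(j : ℝ) - (mk n k : ℝ)| ≤ (mk n k : ℝ) ^ ((3 : ℝ) / 4) →
      j₀ ≤ j ∧ n ≤ 5 * j ∧ 2 * j ≤ n.choose 2 := by
  have hk1 : (2 : ℝ) ≤ (k : ℝ) - 1 := by
    have : (3 : ℝ) ≤ k := by exact_mod_cast hk
    linarith
  have hαpos : 0 < (2 : ℝ) / ((k : ℝ) - 1) := div_pos two_pos (by linarith)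
  have hα1 : (2 : ℝ) / ((k : ℝ) - 1) ≤ 1 := by rw [div_le_one (by linarith)]; exact hk1
  have hr : Tendsto (fun n : ℕ => (n : ℝ) ^ (-(2 : ℝ) / ((k : ℝ) - 1))) atTop (nhds 0) := by
    have := (tendsto_rpow_neg_atTop hαpos).comp tendsto_natCast_atTop_atTop
    refine this.congr fun n => ?_
    rw [Function.comp_apply, neg_div]
  filter_upwards [hr.eventually (gt_mem_nhds (by norm_num : (0 : ℝ) < 1 / 4)),
    eventually_ge_atTop (max 35 (4 * j₀ + 3))] with n hn4 hn j hj
  have hn35 : 35 ≤ n := (le_max_left _ _).trans hn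
  have hnj₀ : 4 * j₀ + 3 ≤ n := (le_max_right _ _).trans hn
  have hnR : (35 : ℝ) ≤ n := by exact_mod_cast hn35
  have hnpos : (0 : ℝ) < n := by linarith
  have hn0 : (n : ℝ) ≠ 0 := hnpos.ne'
  have hr0 : 0 ≤ (n : ℝ) ^ (-(2 : ℝ) / ((k : ℝ) - 1)) := Real.rpow_nonneg hnpos.le _
  have hN : ((n.choose 2 : ℕ) : ℝ) = n * (n - 1) / 2 := Nat.cast_choose_two (K := ℝ) n
  have hNr0 : 0 ≤ ((n.choose 2 : ℕ) : ℝ) * (n : ℝ) ^ (-(2 : ℝ) / ((k : ℝ) - 1)) :=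
    mul_nonneg (Nat.cast_nonneg _) hr0
  -- `m_k` against `C(n,2) · n^{-2/(k-1)}`
  have hm_le : (mk n k : ℝ) ≤ ((n.choose 2 : ℕ) : ℝ) * (n : ℝ) ^ (-(2 : ℝ) / ((k : ℝ) - 1)) :=
    Nat.floor_le hNr0
  have hm_ge : ((n.choose 2 : ℕ) : ℝ) * (n : ℝ) ^ (-(2 : ℝ) / ((k : ℝ) - 1)) - 1 < (mk n k : ℝ) :=
    Nat.sub_one_lt_floor _
  -- `C(n,2) · n^{-2/(k-1)} ≥ (n-1)/2`
  have hr_ge : (n : ℝ) ^ (-(1 : ℝ)) ≤ (n : ℝ) ^ (-(2 : ℝ) / ((k : ℝ) - 1)) := by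
    refine Real.rpow_le_rpow_of_exponent_le (by linarith) ?_
    rw [neg_div, neg_le_neg_iff]; exact hα1
  have hNr_ge : ((n : ℝ) - 1) / 2 ≤ ((n.choose 2 : ℕ) : ℝ) * (n : ℝ) ^ (-(2 : ℝ) / ((k : ℝ) - 1)) := by
    calc ((n : ℝ) - 1) / 2 = ((n.choose 2 : ℕ) : ℝ) * (n : ℝ) ^ (-(1 : ℝ)) := by
          rw [hN, Real.rpow_neg_one]; field_simp
      _ ≤ _ := mul_le_mul_of_nonneg_left hr_ge (Nat.cast_nonneg _)
  -- `C(n,2) · n^{-2/(k-1)} ≤ C(n,2)/4`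
  have hNr_le : ((n.choose 2 : ℕ) : ℝ) * (n : ℝ) ^ (-(2 : ℝ) / ((k : ℝ) - 1)) ≤ ((n.choose 2 : ℕ) : ℝ) / 4 := by
    have := mul_le_mul_of_nonneg_left hn4.le (Nat.cast_nonneg (n.choose 2) : (0 : ℝ) ≤ _)
    linarith
  have hm16 : (16 : ℝ) ≤ (mk n k : ℝ) := by linarith
  have h34 := rpow_three_quarters_le_half hm16
  obtain ⟨hj1, hj2⟩ := abs_sub_le_iff.1 hj
  have hjlo : (mk n k : ℝ) / 2 ≤ j := by linarith
  have hjhi : (j : ℝ) ≤ 3 * (mk n k : ℝ) / 2 := by linarith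
  refine ⟨?_, ?_, ?_⟩
  · have h' : ((4 * j₀ + 3 : ℕ) : ℝ) ≤ n := by exact_mod_cast hnj₀
    push_cast at h'
    have : (j₀ : ℝ) ≤ j := by linarith
    exact_mod_cast this
  · have : (n : ℝ) ≤ 5 * j := by linarith
    exact_mod_cast this
  · have : (2 * j : ℝ) ≤ ((n.choose 2 : ℕ) : ℝ) := by linarith
    exact_mod_cast this

/-- Size bookkeeping for the test circuit: `2(s + C(n,k) + 1) + 5 ≤ j^{2(c+k)+8}` when `s ≤ n^c`,
`n ≤ 5j`, `j ≥ 5`, `n ≥ 2`. [folklore] -/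
theorem size_bound {n j c k s : ℕ} (hn : 2 ≤ n) (hj : 5 ≤ j) (hnj : n ≤ 5 * j) (hs : s ≤ n ^ c) :
    2 * (s + (n.choose k + 1)) + 5 ≤ j ^ (2 * (c + k) + 8) := by
  have h1 : n.choose k ≤ n ^ k := Nat.choose_le_pow n k
  have hn1 : 1 ≤ n := by omega
  have hck : n ^ c ≤ n ^ (c + k) := Nat.pow_le_pow_right hn1 (by omega)
  have hkc : n ^ k ≤ n ^ (c + k) := Nat.pow_le_pow_right hn1 (by omega)
  have h0 : 1 ≤ n ^ (c + k) := Nat.one_le_pow _ _ hn1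
  have h11 : 2 * (s + (n.choose k + 1)) + 5 ≤ 11 * n ^ (c + k) := by omega
  have h16 : 16 ≤ n ^ 4 := by
    have := Nat.pow_le_pow_left hn 4
    simpa using this
  have hstep : 11 * n ^ (c + k) ≤ n ^ (c + k + 4) := by
    calc 11 * n ^ (c + k) ≤ 16 * n ^ (c + k) := by omega
      _ ≤ n ^ 4 * n ^ (c + k) := Nat.mul_le_mul_right _ h16
      _ = n ^ (c + k + 4) := by ring
  have hn_le : n ^ (c + k + 4) ≤ (5 * j) ^ (c + k + 4) := Nat.pow_le_pow_left hnj _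
  have h5j : 5 * j ≤ j * j := Nat.mul_le_mul_right j hj
  have hjj : (5 * j) ^ (c + k + 4) ≤ (j * j) ^ (c + k + 4) := Nat.pow_le_pow_left h5j _
  have hfin : (j * j) ^ (c + k + 4) = j ^ (2 * (c + k) + 8) := by
    rw [← pow_two, ← pow_mul, show 2 * (c + k + 4) = 2 * (c + k) + 8 by ring]
  omega

variable {n : ℕ}

/-- **The test circuit `G = [C ≠ CLIQUE_k]`** over `acBasis`: `acDepth ≤ d + 4`, `≤ 2(|C| + C(n,k) + 1) + 5` gates
(`(C ∧ ¬K) ∨ (¬C ∧ K)` with `K` the exhaustive clique DNF `exists_cliqueDNF_monotoneAC`; `ACReal` toolkit). [folklore] -/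
theorem exists_xorClique_circuit (k : ℕ) {d : ℕ} (C : Circuit (Edge n)) (hC : C.IsOver acBasis)
    (hd : C.acDepth ≤ d) :
    ∃ G : Circuit (Edge n), G.IsOver acBasis ∧ G.acDepth ≤ d + 4 ∧
      G.size ≤ 2 * (C.size + (n.choose k + 1)) + 5 ∧ ∀ x, G.eval x = (C.eval x != cliqueFn n k x) := by
  obtain ⟨K, hKB, hKd, hKs, hKe⟩ := exists_cliqueDNF_monotoneAC n k
  have hCr : ACReal C.eval (max d 2) C.size :=
    (ACReal.of_circuit C hC hd le_rfl).mono (le_max_left _ _) le_rfl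
  have hKr : ACReal (cliqueFn n k) (max d 2) (n.choose k + 1) :=
    ((ACReal.of_circuit K (hKB.mono monotoneACBasis_subset_acBasis)
      ((acDepth_le_depth K).trans hKd) hKs).congr hKe).mono (le_max_right _ _) le_rfl
  have h1 := acReal_and hCr hKr.neg
  have h2 := acReal_and hCr.neg hKr
  have h3 := acReal_or h1 h2
  have h4 : ACReal (fun x => (C.eval x != cliqueFn n k x)) (max d 2 + 1 + 1)
      (C.size + (n.choose k + 1 + 1) + 1 + (C.size + 1 + (n.choose k + 1) + 1) + 1) :=
    h3.congr fun x => by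
      cases hc : C.eval x <;> cases hq : cliqueFn n k x <;> simp
  obtain ⟨G, hGB, hGd, hGs, hGe⟩ := h4.toCircuit
  exact ⟨G, hGB, hGd.trans (by omega), hGs.trans (by omega), hGe⟩

/-- `|E(K_n)| = C(n,2)` (re-export of `card_edgeSet_top_fin`). [folklore] -/
theorem card_edge (n : ℕ) : Fintype.card (Edge n) = n.choose 2 := card_edgeSet_top_fin n

/-- On edge vectors the slice average of `G = [C ≠ K]` is the Disproof's `sliceErr / sliceCard`
(`wt = edgeCount` definitionally). [folklore] -/
theorem sliceAvg_edge_eq (j : ℕ) {C K G : (Edge n → Bool) → Bool} (hG : ∀ x, G x = (C x != K x)) :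
    sliceAvg G j = (sliceErr n j C K : ℝ) / (sliceCard n j : ℝ) := by
  have hnum : (univ.filter fun x : Edge n → Bool => wt x = j ∧ G x = true) =
      (univ.filter fun x : Edge n → Bool => edgeCount x = j ∧ C x ≠ K x) := by
    refine Finset.filter_congr fun x _ => ?_
    rw [hG x]
    exact and_congr Iff.rfl bne_iff_ne
  have hden : (univ.filter fun x : Edge n → Bool => wt x = j) =
      (univ.filter fun x : Edge n → Bool => edgeCount x = j) := rfl
  unfold sliceAvg sliceErr sliceCard
  rw [hnum, hden]

/-- On edge vectors the `μ_q`-average of `G = [C ≠ K]` is `gnpDisagreeProb n q C K`. [folklore] -/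
theorem prodAvg_edge_eq (q : ℝ) {C K G : (Edge n → Bool) → Bool} (hG : ∀ x, G x = (C x != K x)) :
    prodAvg q G = gnpDisagreeProb n q C K := by
  have hfil : (univ.filter fun x : Edge n → Bool => G x = true) =
      (univ.filter fun x : Edge n → Bool => C x ≠ K x) :=
    Finset.filter_congr fun x _ => by rw [hG x]; exact bne_iff_ne
  unfold prodAvg gnpDisagreeProb
  rw [hfil]
  refine Finset.sum_congr rfl fun x _ => ?_
  rw [prodWeight, gnpWeight, card_edge]
  rfl

/-- **The transfer (reduction) `SliceIndist → Hyp → Conc`** — formerly stub S5, now proved. Given `Hyp` and `(d,c)`: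
take `(k, δ_H)` from `Hyp d c`, answer with the same `k` and `δ := δ_H/2`; for large `n`, central `j` and `C` over
`acBasis` of `acDepth ≤ d` with slice error `≤ δ·#slice_j`: either `n^c < |C|` outright, or the test circuit
`G = [C ≠ CLIQUE_k]` (`exists_xorClique_circuit`) has `≤ j^{2(c+k)+8}` gates (`window_eventually`, `size_bound`),
`a_j(G) ≤ δ_H/2` (`sliceAvg_edge_eq`), so `SliceIndist (d+4) (2(c+k)+8) (δ_H/2)` gives
`gnpDisagreeProb n (j/C(n,2)) C CLIQUE_k = E_{j/C(n,2)} G ≤ δ_H` (`prodAvg_edge_eq`), and `Hyp` at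
`q = j/C(n,2) ∈ [0,1]` — window clause `|q·C(n,2) − m_k| = |j − m_k|` verbatim — yields `n^c < |C|`. [folklore] -/
theorem transfer (hI : SliceIndist) : CruxHyp → CruxConc := by
  intro hH d c
  obtain ⟨k, hk3, δH, hδH, hHyp⟩ := hH d c
  refine ⟨k, hk3, δH / 2, half_pos hδH, ?_⟩
  obtain ⟨j₀, hj₀⟩ := hI (d + 4) (2 * (c + k) + 8) (δH / 2) (half_pos hδH)
  filter_upwards [hHyp, window_eventually hk3 (max j₀ 5), eventually_ge_atTop 2] with n hn hw hn2 j hj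
    C hC hd herr
  obtain ⟨hjj₀, hnj, h2j⟩ := hw j hj
  have hj₀j : j₀ ≤ j := (le_max_left _ _).trans hjj₀
  have hj5 : 5 ≤ j := (le_max_right _ _).trans hjj₀
  by_cases hbig : n ^ c < C.size
  · exact hbig
  have hs : C.size ≤ n ^ c := not_lt.1 hbig
  -- the test circuit and its size
  obtain ⟨G, hGB, hGd, hGs, hGe⟩ := exists_xorClique_circuit k C hC hd
  have hGsz : G.size ≤ j ^ (2 * (c + k) + 8) := hGs.trans (size_bound hn2 hj5 hnj hs)
  -- indistinguishability of slice `j` and `G(n, j/C(n,2))` for `G`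
  have h2j' : 2 * j ≤ Fintype.card (Edge n) := by rw [card_edge]; exact h2j
  have key := hj₀ (Edge n) j hj₀j h2j' G hGB hGd hGsz
  rw [card_edge, sliceAvg_edge_eq j hGe, prodAvg_edge_eq _ hGe] at key
  -- slice error ≤ δ_H/2, hence G(n,q)-error ≤ δ_H
  have hsl : (sliceErr n j C.eval (cliqueFn n k) : ℝ) / (sliceCard n j : ℝ) ≤ δH / 2 :=
    div_le_of_le_mul₀ (Nat.cast_nonneg _) (half_pos hδH).le herr
  have hgnp : gnpDisagreeProb n ((j : ℝ) / ((n.choose 2 : ℕ) : ℝ)) C.eval (cliqueFn n k) ≤ δH := by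
    have := (abs_sub_le_iff.1 key).1
    linarith
  -- fire `Hyp` at `q = j / C(n,2)`
  have hNpos : (0 : ℝ) < ((n.choose 2 : ℕ) : ℝ) := by exact_mod_cast (show 0 < n.choose 2 by omega)
  have hq0 : 0 ≤ (j : ℝ) / ((n.choose 2 : ℕ) : ℝ) := div_nonneg (Nat.cast_nonneg _) hNpos.le
  have hq1 : (j : ℝ) / ((n.choose 2 : ℕ) : ℝ) ≤ 1 := by
    rw [div_le_one hNpos]; exact_mod_cast (show j ≤ n.choose 2 by omega)
  have hqw : |(j : ℝ) / ((n.choose 2 : ℕ) : ℝ) * ((n.choose 2 : ℕ) : ℝ) - (mk n k : ℝ)| ≤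
      (mk n k : ℝ) ^ ((3 : ℝ) / 4) := by
    rw [div_mul_cancel₀ _ hNpos.ne']; exact hj
  exact hn _ hq0 hq1 hqw C hC hd hgnp

end Transfer

/-! ### The kernel-checked composition -/

/-- **Composition.** The five stubs imply the crux BY NAME: S1–S3 and Boppana (`boppana_of` S4a S4b) give `SliceIndist` (`sliceIndist_of`), the
proved `transfer` turns it into `Hyp → Conc`, which is `SliceACZero` read back (`sliceACZero_iff`). No `sorry`. -/
theorem SliceACZero_of (hCoupling : Registered.stub_sliceCoupling)
    (hHazard : Registered.stub_binomialHazard) (hAndCoin : Registered.stub_andCoin)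
    (hFourier : Registered.stub_influenceFourier) (hTal : Registered.stub_talInfluence) :
    Summit.PneNP.PneNP.Theses.OneSlice.SliceACZero :=
  sliceACZero_iff.2 (transfer (sliceIndist_of hCoupling hHazard hAndCoin (boppana_of hFourier hTal)))

/-- The same composition fed with the registered stubs (the crux modulo the five `stub_*` sorries; an
`example`, so that `SliceACZero_of` stays the unique theorem concluding the crux). -/
example : Summit.PneNP.PneNP.Theses.OneSlice.SliceACZero :=
  SliceACZero_of stub_sliceCoupling stub_binomialHazard stub_andCoin stub_influenceFourier stub_talInfluence

/-- **The crux, sorry-free** (drefute gen-3 assembly: the lead's kernel-checked composition fed with the five proved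
stubs). NOT for landing by a refuter — candidate proof evidence for the lead / a prover. -/
theorem sliceACZero_proved : Summit.PneNP.PneNP.Theses.OneSlice.SliceACZero :=
  SliceACZero_of stub_sliceCoupling stub_binomialHazard stub_andCoin stub_influenceFourier stub_talInfluence

end Summit.PneNP.PneNP.Cruxes.SliceACZero.DrefuteG3Complete

end
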